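import Literature.NumberTheory.Sieve.MoebiusShiftedPrimesDirichletTools
import Literature.NumberTheory.LFunctions.HalaszMontgomeryInequality
import HarnessLib

/-!
# Möbius on shifted primes — Proposition 5.1 of Lichtman 2020 along `S_c`, proved

Topic `Literature/NumberTheory/Sieve`, part of the decomposition of the named facts
`Literature.NumberTheory.Sieve.lichtman2020_moebius_shifted_primes_avg` and
`Literature.NumberTheory.Sieve.lichtman2020_moebius_shifted_primes_avg_power` (J. D. Lichtman,
*Averages of the Möbius function on shifted primes*, Q. J. Math. 73 (2022) 729–757,
arXiv:2009.08969v2 [Lichtman2020], Theorem 1.1) along the corrected chain of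
`MoebiusShiftedPrimesTypical.lean`.  Everything here is PROVED; the result is

* `Lichtman2020_dirichletMeanValueWith_of_primeCharacterSum :
    Lichtman2020_primeCharacterSum → Lichtman2020_dirichletMeanValueWith`

(Proposition 5.1 along `S_c = lichtmanTypicalWith c`, `c ≥ 100`, from Lemma 4.5 as the only named
fact, Lemmas 4.1, 4.3, 4.4, 4.7 being proved in the tree), through the stronger
`Lichtman2020.dirichletMeanValue_strong` (`Y ∈ [X/(log X)^{6A}, 2X]`, `T ∈ [0, 2X]`; the deduction of
Proposition 3.4, `MoebiusShiftedPrimesMeanSquareTools.lean`, uses the scales `Y` and `2Y`).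

## The argument (§5.1, pp. 14–15, discretised; parameters `B = 11A`, `V = L^B`, `T₀ = L^{2B}`,
`α = 1/6`, `K = 22A`, `L = log X`, `P₁ = L^{cA}`, `Q₁ = H/L^{4A}`, `[P₂,Q₂]` as printed)

Cover `[T₀, T]` by unit intervals `[n, n+1)`; call `n` GOOD if `|Q_{v,1}(1+it)| ≤ e^{-αv/V}` for all
`t ∈ [n,n+1]`, `v ∈ ℐ₁`, BAD otherwise (`𝒯₁`, `𝒯₂` = the unions; both measurable, set integrals are
sums of interval integrals).  Lemma 4.7 on `𝒯₁` with `[P₁,Q₁]` (`b = λχ𝟙_{HasPF[P₂,Q₂]}`) and on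
`𝒯₂` with `[P₂,Q₂]` (`b = λχ𝟙_{HasPF[P₁,Q₁]}`); the coprime sums vanish (`prop51_fixed`).
* `E₁` (`E1_block`, `E1_sum`): on good intervals `|Q_v|² ≤ e^{-2αv/V}`; `∫_{𝒯₁}|R_v|² ≤ ∫_{-T'}^{T'}
  ≤ 10 Q₁T'/Y + 72` (Lemma 4.1, `M_v ≥ Y/Q₁`); the geometric tail gives the factor
  `e^{2α/V} P₁^{-2α} (1 + V/2α)` — with the `V` that the printed proof loses (module docstring of
  `MoebiusShiftedPrimesTypical.lean`); `V² P₁^{-1/3} L ≤ L^{-11A}` needs `cA/3 ≥ 33A + 1`, i.e. `c ≥ 100`.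
* `E₂` (`E2_block`): on a bad interval bound `|Q_{v,2}|² ≤ U²` (Lemma 4.5 at scale `X²`:
  `U = 3C₄₅ L^{1-22A}`, `UQ_bound`) and `|R_v|²` by its maximum `|R_v(t_n)|²`; the `t_n` of even
  (odd) `n` are well spaced, and Lemma 4.3 gives `≤ 10 C₉ U² log(2T')` once `#bad · √T' ≤ M_v`.
* The count of bad intervals (`card_bad_le`, `cardB_bound`, (5.10)): each bad `n` carries a witness
  `|Q_{u,1}(1+is_n)| > e^{-αu/V}`; per `u` and parity these are well spaced, and Lemma 4.4 (explicit
  form) bounds them by `576 e^{2αu/V} T'^{2α} exp(16 (V log T'/u) log log T')`; with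
  `u ≥ ⌊V log P₁⌋ ≥ V cA log L/2` and `log log T' ≤ 2 log L` the last factor is `≤ T'^{64/(cA)}`, so
  `#bad √T' ≤ 2304 V L e^{L^{2/3}/3} (3X)^{5/6 + 64/(cA)} ≤ Y/Q₂` eventually (`α = 1/6` leaves the
  room `1/6 > 64/500`); for `T' ≤ X^{1/4}` the trivial count `#bad ≤ T'` is used instead.
* `dirichletMeanValue_strong`: the eventual side conditions (`eventually_small_terms` &c.), the
  degenerate cases `Q₂ < P₂` (then `S_c = ∅`) and `T < T₀`, and the final numerics
  (`E1_factor_numerics`, `E2_factor_numerics`, `err_numerics`, `final_numerics`) giving the constant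
  `C = C₁₂⁺ (2000 + 720 C₉⁺ C₄₅⁺²)`.

## Faithfulness notes

* Deviations from print are those recorded at `Lichtman2020_dirichletMeanValueWith`
  (`MoebiusShiftedPrimesTypical.lean`): `P₁ = (log X)^{cA}`, `c ≥ 100`; the ranges of `Y` and `T`; the
  omitted cut-off `n ≤ X/d`.  The discretisation "good/bad unit intervals" replaces the paper's
  pointwise sets `𝒯₁ = {t : |Q_{v,1}(1+it)| ≤ e^{-αv/V} ∀v}`, `𝒯₂`; it only shrinks `𝒯₁`, and on `𝒯₂`
  the paper also passes to unit intervals ("`∑_n sup_{t_n ∈ [n,n+1] ∩ 𝒯₂}`", p. 15).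
* `α = 1/6` instead of the printed `1/5` (any `α < 1/4` works in print; `1/6` leaves room for the
  explicit exponent `16` of Lemma 4.4 as proved in the tree); `K = 22A` and the scale `X²` in
  Lemma 4.5 (to cover `|t| ≤ 2X + 1 > X`).

## Sources

* J. D. Lichtman, arXiv:2009.08969v2, Proposition 5.1 and §5.1, (5.7)–(5.10), pp. 14–15; §4 pp. 11–13
  [Lichtman2020].
* K. Matomäki, M. Radziwiłł, Ann. of Math. (2) 183 (2016), §8 [MatomakiRadziwillAnnals2016].
-/

noncomputable section

open Finset Real Complex MeasureTheory Filter
open scoped Topology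


namespace Literature.NumberTheory.Sieve.Lichtman2020

/-! ### The window of the cofactor polynomial -/

/-- For `y = X e^{-v/H} > 0`: `M = ⌈y⌉ ≥ 1` and `N = ⌊2Xe^{-v/H}⌋ ≤ 2M`. [folklore] -/
theorem cofactorWindow_bounds {X H : ℝ} (hX : 0 < X) (v : ℕ) :
    1 ≤ ⌈X * Real.exp (-(v / H))⌉₊ ∧
      ⌊2 * X * Real.exp (-(v / H))⌋₊ ≤ 2 * ⌈X * Real.exp (-(v / H))⌉₊ := by
  have hy : 0 < X * Real.exp (-(v / H)) := mul_pos hX (Real.exp_pos _)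
  have := window_bounds hy
  rwa [show 2 * (X * Real.exp (-(v / H))) = 2 * X * Real.exp (-(v / H)) by ring] at this

/-- For `v ≤ ⌊H log Q⌋` (`Q ≥ 1`, `H > 0`): `X/Q ≤ X e^{-v/H} ≤ ⌈X e^{-v/H}⌉`. [folklore] -/
theorem div_le_cofactorWindow {X H Q : ℝ} (hX : 0 ≤ X) (hH : 0 < H) (hQ : 1 ≤ Q) {v : ℕ}
    (hv : v ≤ ⌊H * Real.log Q⌋₊) : X / Q ≤ ⌈X * Real.exp (-(v / H))⌉₊ := by
  have hQ0 : 0 < Q := by linarith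
  have h0 : 0 ≤ H * Real.log Q := mul_nonneg hH.le (Real.log_nonneg hQ)
  have h1 : (v : ℝ) ≤ Real.log Q * H := by
    calc (v : ℝ) ≤ H * Real.log Q := (Nat.cast_le.mpr hv).trans (Nat.floor_le h0)
      _ = Real.log Q * H := mul_comm _ _
  have h2 : 1 / Q ≤ Real.exp (-(v / H)) := by
    have e : 1 / Q = Real.exp (-Real.log Q) := by
      rw [Real.exp_neg, Real.exp_log hQ0, one_div]
    rw [e, Real.exp_le_exp, neg_le_neg_iff, div_le_iff₀ hH]
    exact h1
  calc X / Q = X * (1 / Q) := by ring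
    _ ≤ X * Real.exp (-(v / H)) := mul_le_mul_of_nonneg_left h2 hX
    _ ≤ ⌈X * Real.exp (-(v / H))⌉₊ := Nat.le_ceil _

/-! ### `E₁`: the good intervals (mean value theorem) -/

/-- **One block of `E₁`**: if `|Q_v(1+it)| ≤ ρ` on every good unit interval then
`∑_{n good} ∫_n^{n+1} |Q_v R_v|² ≤ ρ² (10 T'/M_v + 72)`, `T' = N_max + 1`, by the mean value theorem
(`intervalIntegral_norm_sq_window_le`). [cite: Lichtman2020, §5.1, bound for E₁] -/
theorem E1_block {c b : ℕ → ℂ} (hb : ∀ m, ‖b m‖ ≤ 1) {X P Q H ρ : ℝ} (hX : 0 < X)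
    (v Nmax : ℕ) (G : Finset ℕ) (hG : ∀ n ∈ G, n ≤ Nmax)
    (hgood : ∀ n ∈ G, ∀ t ∈ Set.Icc (n : ℝ) (n + 1), ‖blockPrimePoly c P Q H v t‖ ≤ ρ) :
    ∑ n ∈ G, ∫ t in (n : ℝ)..((n + 1 : ℕ) : ℝ),
        ‖blockPrimePoly c P Q H v t * blockCofactorPoly b X P Q H v t‖ ^ 2 ≤
      ρ ^ 2 * (10 * ((Nmax : ℝ) + 1) / ⌈X * Real.exp (-(v / H))⌉₊ + 72) := by
  set r : ℝ → ℝ := fun t => ‖blockCofactorPoly b X P Q H v t‖ ^ 2 with hr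
  have hrc : Continuous r := (continuous_blockCofactorPoly b X P Q H v).norm.pow 2
  have hr0 : ∀ t, 0 ≤ r t := fun t => by positivity
  have hqc : Continuous fun t => ‖blockPrimePoly c P Q H v t‖ ^ 2 :=
    (continuous_blockPrimePoly c P Q H v).norm.pow 2
  -- each good interval
  have hpiece : ∀ n ∈ G, ∫ t in (n : ℝ)..((n + 1 : ℕ) : ℝ),
      ‖blockPrimePoly c P Q H v t * blockCofactorPoly b X P Q H v t‖ ^ 2 ≤
      ρ ^ 2 * ∫ t in (n : ℝ)..((n + 1 : ℕ) : ℝ), r t := by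
    intro n hn
    have hle : (n : ℝ) ≤ ((n + 1 : ℕ) : ℝ) := by push_cast; linarith
    rw [← intervalIntegral.integral_const_mul]
    refine intervalIntegral.integral_mono_on hle ?_ ?_ fun t ht => ?_
    · exact ((hqc.mul hrc).congr fun t => by simp [hr, mul_pow]).intervalIntegrable _ _
    · exact (continuous_const.mul hrc).intervalIntegrable _ _
    · have ht' : t ∈ Set.Icc (n : ℝ) (n + 1) := by simpa using ht
      rw [norm_mul, mul_pow]
      refine mul_le_mul_of_nonneg_right ?_ (hr0 t)
      exact pow_le_pow_left₀ (norm_nonneg _) (hgood n hn t ht') 2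
  -- sum over the good intervals, then extend to all `n ≤ Nmax`
  have hsum : ∑ n ∈ G, ∫ t in (n : ℝ)..((n + 1 : ℕ) : ℝ), r t ≤
      ∑ n ∈ Finset.range (Nmax + 1), ∫ t in (n : ℝ)..((n + 1 : ℕ) : ℝ), r t := by
    refine Finset.sum_le_sum_of_subset_of_nonneg (fun n hn => Finset.mem_range.mpr
      (Nat.lt_succ_of_le (hG n hn))) fun n _ _ => ?_
    exact intervalIntegral.integral_nonneg (by push_cast; linarith) fun t _ => hr0 t
  have hadj : ∑ n ∈ Finset.range (Nmax + 1), ∫ t in (n : ℝ)..((n + 1 : ℕ) : ℝ), r t =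
      ∫ t in (0 : ℝ)..((Nmax + 1 : ℕ) : ℝ), r t := by
    have := intervalIntegral.sum_integral_adjacent_intervals (a := fun n : ℕ => (n : ℝ))
      (n := Nmax + 1) (f := r) (μ := volume) (fun k _ => hrc.intervalIntegrable _ _)
    simpa using this
  have hT' : (0 : ℝ) < (Nmax : ℝ) + 1 := by positivity
  have hext : ∫ t in (0 : ℝ)..((Nmax + 1 : ℕ) : ℝ), r t ≤ ∫ t in (-((Nmax : ℝ) + 1))..((Nmax : ℝ) + 1), r t := by
    refine intervalIntegral.integral_mono_interval (by linarith) (by positivity)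
      (le_of_eq (by push_cast; ring)) (Filter.Eventually.of_forall hr0) (hrc.intervalIntegrable _ _)
  obtain ⟨hM1, hNM⟩ := cofactorWindow_bounds (H := H) hX v
  have hMV := intervalIntegral_norm_sq_window_le
    (w := fun m => b m / ((primeDivisorsIn P Q m : ℂ) + 1))
    (fun m => norm_div_primeDivisorsIn_le hb P Q m) hM1 hNM hT'
  have hwin : ∀ t, r t = ‖∑ m ∈ Icc ⌈X * Real.exp (-(v / H))⌉₊ ⌊2 * X * Real.exp (-(v / H))⌋₊,
      (b m / ((primeDivisorsIn P Q m : ℂ) + 1)) * (m : ℂ) ^ (-(1 + (t : ℂ) * I))‖ ^ 2 := by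
    intro t; simp only [hr, blockCofactorPoly_eq_window]
  calc ∑ n ∈ G, ∫ t in (n : ℝ)..((n + 1 : ℕ) : ℝ),
        ‖blockPrimePoly c P Q H v t * blockCofactorPoly b X P Q H v t‖ ^ 2
      ≤ ∑ n ∈ G, ρ ^ 2 * ∫ t in (n : ℝ)..((n + 1 : ℕ) : ℝ), r t := Finset.sum_le_sum hpiece
    _ = ρ ^ 2 * ∑ n ∈ G, ∫ t in (n : ℝ)..((n + 1 : ℕ) : ℝ), r t := by rw [Finset.mul_sum]
    _ ≤ ρ ^ 2 * ∫ t in (-((Nmax : ℝ) + 1))..((Nmax : ℝ) + 1), r t := by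
        refine mul_le_mul_of_nonneg_left ?_ (by positivity)
        exact hsum.trans (hadj.le.trans hext)
    _ ≤ ρ ^ 2 * (10 * ((Nmax : ℝ) + 1) / ⌈X * Real.exp (-(v / H))⌉₊ + 72) := by
        refine mul_le_mul_of_nonneg_left ?_ (by positivity)
        simp_rw [hwin]
        exact hMV

/-- **`E₁` summed over the blocks**: with `ρ_v = e^{-αv/V}` and `M_v ≥ Y/Q₁`,
`∑_{v=v₀}^{v₁} ∑_{good} ∫ |Q_vR_v|² ≤ e^{2α/V} P₁^{-2α} (1 + V/(2α)) (10 Q₁T'/Y + 72)`, where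
`v₀ = ⌊V log P₁⌋`, `v₁ = ⌊V log Q₁⌋`.  The factor `V` in front of `P₁^{-2α}` is the one the printed
proof loses (module docstring of `MoebiusShiftedPrimesTypical.lean`). [cite: Lichtman2020, §5.1, bound for E₁] -/
theorem E1_sum {c b : ℕ → ℂ} (hb : ∀ m, ‖b m‖ ≤ 1) {Y P₁ Q₁ V α : ℝ} (hY : 0 < Y) (hP₁ : 1 ≤ P₁)
    (hQ₁ : 1 ≤ Q₁) (hV : 0 < V) (hα : 0 < α) (Nmax : ℕ) (G : Finset ℕ) (hG : ∀ n ∈ G, n ≤ Nmax)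
    (hgood : ∀ n ∈ G, ∀ t ∈ Set.Icc (n : ℝ) (n + 1), ∀ v ∈ Icc ⌊V * Real.log P₁⌋₊ ⌊V * Real.log Q₁⌋₊,
      ‖blockPrimePoly c P₁ Q₁ V v t‖ ≤ Real.exp (-(α * v / V))) :
    ∑ v ∈ Icc ⌊V * Real.log P₁⌋₊ ⌊V * Real.log Q₁⌋₊, ∑ n ∈ G, ∫ t in (n : ℝ)..((n + 1 : ℕ) : ℝ),
        ‖blockPrimePoly c P₁ Q₁ V v t * blockCofactorPoly b Y P₁ Q₁ V v t‖ ^ 2 ≤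
      Real.exp (2 * α / V) * P₁ ^ (-(2 * α)) * (1 + V / (2 * α)) *
        (10 * Q₁ * ((Nmax : ℝ) + 1) / Y + 72) := by
  set v₀ := ⌊V * Real.log P₁⌋₊ with hv₀
  set v₁ := ⌊V * Real.log Q₁⌋₊ with hv₁
  set K : ℝ := 10 * Q₁ * ((Nmax : ℝ) + 1) / Y + 72 with hK
  have hK0 : 0 ≤ K := by positivity
  -- each block
  have hblock : ∀ v ∈ Icc v₀ v₁, ∑ n ∈ G, ∫ t in (n : ℝ)..((n + 1 : ℕ) : ℝ),
      ‖blockPrimePoly c P₁ Q₁ V v t * blockCofactorPoly b Y P₁ Q₁ V v t‖ ^ 2 ≤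
      Real.exp (-(2 * α / V * v)) * K := by
    intro v hv
    have h1 := E1_block (c := c) hb hY v Nmax G hG
      (fun n hn t ht => hgood n hn t ht v hv)
    refine h1.trans ?_
    have hρ2 : Real.exp (-(α * v / V)) ^ 2 = Real.exp (-(2 * α / V * v)) := by
      rw [← Real.exp_nat_mul]; congr 1; push_cast; ring
    rw [hρ2]
    refine mul_le_mul_of_nonneg_left ?_ (Real.exp_pos _).le
    have hM : Y / Q₁ ≤ ⌈Y * Real.exp (-(v / V))⌉₊ :=
      div_le_cofactorWindow hY.le hV hQ₁ (Finset.mem_Icc.mp hv).2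
    have hM0 : (0 : ℝ) < ⌈Y * Real.exp (-(v / V))⌉₊ := by
      have := (cofactorWindow_bounds (H := V) hY v).1
      exact_mod_cast this
    have hQ₁0 : 0 < Q₁ := by linarith
    have : 10 * ((Nmax : ℝ) + 1) / ⌈Y * Real.exp (-(v / V))⌉₊ ≤ 10 * Q₁ * ((Nmax : ℝ) + 1) / Y := by
      rw [div_le_div_iff₀ hM0 hY]
      calc 10 * ((Nmax : ℝ) + 1) * Y = 10 * ((Nmax : ℝ) + 1) * (Y / Q₁) * Q₁ := by field_simp
        _ ≤ 10 * ((Nmax : ℝ) + 1) * ⌈Y * Real.exp (-(v / V))⌉₊ * Q₁ := by gcongr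
        _ = 10 * Q₁ * ((Nmax : ℝ) + 1) * ⌈Y * Real.exp (-(v / V))⌉₊ := by ring
    linarith
  refine (Finset.sum_le_sum hblock).trans ?_
  rw [← Finset.sum_mul]
  refine mul_le_mul_of_nonneg_right ?_ hK0
  -- the geometric tail
  have hs : 0 < 2 * α / V := by positivity
  refine (sum_exp_neg_mul_le hs v₀ v₁).trans ?_
  have h1s : 1 + 1 / (2 * α / V) = 1 + V / (2 * α) := by field_simp
  rw [h1s]
  refine mul_le_mul_of_nonneg_right ?_ (by positivity)
  -- `e^{-(2α/V) v₀} ≤ e^{2α/V} P₁^{-2α}` as `v₀ ≥ V log P₁ - 1`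
  have hP₁0 : 0 < P₁ := by linarith
  have hlog : 0 ≤ V * Real.log P₁ := mul_nonneg hV.le (Real.log_nonneg hP₁)
  have hv₀ge : V * Real.log P₁ - 1 ≤ (v₀ : ℝ) := by
    have := Nat.lt_floor_add_one (V * Real.log P₁)
    rw [hv₀]; linarith
  rw [Real.rpow_def_of_pos hP₁0, ← Real.exp_add, Real.exp_le_exp]
  have : -(2 * α / V * (v₀ : ℝ)) ≤ -(2 * α / V * (V * Real.log P₁ - 1)) := by
    apply neg_le_neg
    exact mul_le_mul_of_nonneg_left hv₀ge hs.le
  refine this.trans (le_of_eq ?_)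
  field_simp
  ring

/-! ### `E₂`: the bad intervals (Halász–Montgomery at well-spaced maximisers) -/

/-- **One block of `E₂`**: if `|Q_v| ≤ U` on the bad unit intervals `n ∈ B ⊆ [0, N_max]` and
`#B √T' ≤ M_v` (`T' = N_max + 1`), then
`∑_{n ∈ B} ∫_n^{n+1} |Q_v R_v|² ≤ 10 C₉⁺ U² log(2T')`: on `[n, n+1]` bound `|R_v|²` by its maximum
`|R_v(t_n)|²`, split `n` by parity so that the `t_n` are well spaced, and apply Lemma 9 to each class.
[cite: Lichtman2020, §5.1, bound for E₂] -/
theorem E2_block {C₉ : ℝ} (h9 : Lemma9With C₉) {c b : ℕ → ℂ} (hb : ∀ m, ‖b m‖ ≤ 1)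
    {X P Q H U : ℝ} (hX : 0 < X) (v Nmax : ℕ) (B : Finset ℕ) (hB : ∀ n ∈ B, n ≤ Nmax)
    (hN1 : 1 ≤ ⌊2 * X * Real.exp (-(v / H))⌋₊)
    (hcard : (#B : ℝ) * Real.sqrt ((Nmax : ℝ) + 1) ≤ ⌈X * Real.exp (-(v / H))⌉₊)
    (hQU : ∀ n ∈ B, ∀ t ∈ Set.Icc (n : ℝ) (n + 1), ‖blockPrimePoly c P Q H v t‖ ≤ U) :
    ∑ n ∈ B, ∫ t in (n : ℝ)..((n + 1 : ℕ) : ℝ),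
        ‖blockPrimePoly c P Q H v t * blockCofactorPoly b X P Q H v t‖ ^ 2 ≤
      10 * max C₉ 0 * U ^ 2 * Real.log (2 * ((Nmax : ℝ) + 1)) := by
  set M := ⌈X * Real.exp (-(v / H))⌉₊ with hMdef
  set N := ⌊2 * X * Real.exp (-(v / H))⌋₊ with hNdef
  set T' : ℝ := (Nmax : ℝ) + 1 with hT'def
  obtain ⟨hM1, hNM⟩ := cofactorWindow_bounds (H := H) hX v
  have hT'1 : 1 ≤ T' := by simp [hT'def]
  set r : ℝ → ℝ := fun t => ‖blockCofactorPoly b X P Q H v t‖ ^ 2 with hr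
  have hrc : Continuous r := (continuous_blockCofactorPoly b X P Q H v).norm.pow 2
  have hr0 : ∀ t, 0 ≤ r t := fun t => by positivity
  have hqc : Continuous fun t => ‖blockPrimePoly c P Q H v t‖ ^ 2 :=
    (continuous_blockPrimePoly c P Q H v).norm.pow 2
  -- maximisers of `r` on the unit intervals
  have hex : ∀ n : ℕ, ∃ t ∈ Set.Icc (n : ℝ) (n + 1), ∀ s ∈ Set.Icc (n : ℝ) (n + 1), r s ≤ r t :=
    fun n => exists_max_unit hrc n
  choose tsel htsel hmax using hex
  -- each bad interval
  have hpiece : ∀ n ∈ B, ∫ t in (n : ℝ)..((n + 1 : ℕ) : ℝ),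
      ‖blockPrimePoly c P Q H v t * blockCofactorPoly b X P Q H v t‖ ^ 2 ≤ U ^ 2 * r (tsel n) := by
    intro n hn
    have h := intervalIntegral_unit_mul_le hqc hrc n (fun t => by positivity) hr0
      (fun t ht => pow_le_pow_left₀ (norm_nonneg _) (hQU n hn t ht) 2) (hmax n)
    refine le_trans (le_of_eq ?_) h
    refine intervalIntegral.integral_congr fun t _ => ?_
    simp [hr, mul_pow]
  refine (Finset.sum_le_sum hpiece).trans ?_
  rw [← Finset.mul_sum]
  -- split by parity and apply Lemma 9 to each class
  have ht : ∀ n ∈ B, (n : ℝ) ≤ tsel n ∧ tsel n ≤ n + 1 := fun n _ => (htsel n)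
  have hclass : ∀ rr : ℕ, ∑ n ∈ B.filter (fun k => k % 2 = rr), r (tsel n) ≤
      max C₉ 0 * ((N : ℝ) + #(B.filter (fun k => k % 2 = rr)) * Real.sqrt T') *
        Real.log (2 * T') * (2 / M) := by
    intro rr
    obtain ⟨hws, hcardW, hsumW⟩ := parity_image_facts ht rr r
    rw [hsumW, ← hcardW]
    have hWT : ∀ s ∈ (B.filter (fun k => k % 2 = rr)).image tsel, |s| ≤ T' := by
      intro s hs
      rw [Finset.mem_image] at hs
      obtain ⟨n, hn, rfl⟩ := hs
      rw [Finset.mem_filter] at hn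
      obtain ⟨h1, h2⟩ := htsel n
      have hn0 : (0 : ℝ) ≤ n := Nat.cast_nonneg n
      have hnN : (n : ℝ) ≤ Nmax := by exact_mod_cast hB n hn.1
      rw [abs_of_nonneg (by linarith)]
      simp only [hT'def]; linarith
    have key := sum_norm_sq_window_le_of_lemma9 h9
      (w := fun m => b m / ((primeDivisorsIn P Q m : ℂ) + 1))
      (fun m => norm_div_primeDivisorsIn_le hb P Q m) hM1 hNM hN1 hT'1 _ hWT hws
    simp only [hr, blockCofactorPoly_eq_window]
    exact key
  have hsplit : ∑ n ∈ B, r (tsel n) =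
      ∑ n ∈ B.filter (fun k => k % 2 = 0), r (tsel n) + ∑ n ∈ B.filter (fun k => k % 2 = 1), r (tsel n) := by
    rw [← Finset.sum_filter_add_sum_filter_not B (fun k => k % 2 = 0)]
    congr 1
    refine Finset.sum_congr ?_ fun _ _ => rfl
    ext k; simp
  have hcards : (#(B.filter (fun k => k % 2 = 0)) : ℝ) + #(B.filter (fun k => k % 2 = 1)) = #B := by
    have := Finset.card_filter_add_card_filter_not (s := B) (fun k => k % 2 = 0)
    have e : B.filter (fun k => ¬ k % 2 = 0) = B.filter (fun k => k % 2 = 1) := by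
      ext k; simp
    rw [e] at this
    exact_mod_cast this
  have hM0 : (0 : ℝ) < M := by exact_mod_cast hM1
  have hC0 : 0 ≤ max C₉ 0 := le_max_right _ _
  have hlog0 : 0 ≤ Real.log (2 * T') := Real.log_nonneg (by linarith)
  have hNM' : (N : ℝ) ≤ 2 * M := by exact_mod_cast hNM
  have htot : ∑ n ∈ B, r (tsel n) ≤ max C₉ 0 * Real.log (2 * T') * (2 / M) * (2 * N + #B * Real.sqrt T') := by
    rw [hsplit]
    refine (add_le_add (hclass 0) (hclass 1)).trans (le_of_eq ?_)
    rw [← hcards]; ring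
  have hfin : max C₉ 0 * Real.log (2 * T') * (2 / M) * (2 * N + #B * Real.sqrt T') ≤
      10 * max C₉ 0 * Real.log (2 * T') := by
    have h5 : (2 / (M : ℝ)) * (2 * N + #B * Real.sqrt T') ≤ 10 := by
      rw [div_mul_eq_mul_div, div_le_iff₀ hM0]
      have : (#B : ℝ) * Real.sqrt T' ≤ M := hcard
      nlinarith
    calc max C₉ 0 * Real.log (2 * T') * (2 / M) * (2 * N + #B * Real.sqrt T')
        = max C₉ 0 * Real.log (2 * T') * ((2 / M) * (2 * N + #B * Real.sqrt T')) := by ring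
      _ ≤ max C₉ 0 * Real.log (2 * T') * 10 := mul_le_mul_of_nonneg_left h5 (by positivity)
      _ = 10 * max C₉ 0 * Real.log (2 * T') := by ring
  calc U ^ 2 * ∑ n ∈ B, r (tsel n) ≤ U ^ 2 * (10 * max C₉ 0 * Real.log (2 * T')) :=
        mul_le_mul_of_nonneg_left (htot.trans hfin) (by positivity)
    _ = 10 * max C₉ 0 * U ^ 2 * Real.log (2 * ((Nmax : ℝ) + 1)) := by simp only [hT'def]; ring

end Literature.NumberTheory.Sieve.Lichtman2020

namespace Literature.NumberTheory.Sieve.Lichtman2020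

/-! ### Counting the bad intervals (Matomäki–Radziwiłł's Lemma 8 on each block `Q_{u,1}`) -/

/-- For `u ≤ ⌊V log Q⌋` (`Q ≥ 1`, `V > 0`): `e^{s u/V} ≤ Q^s` for `s ≥ 0`. [folklore] -/
theorem exp_mul_div_le_rpow {V Q s : ℝ} (hV : 0 < V) (hQ : 1 ≤ Q) (hs : 0 ≤ s) {u : ℕ}
    (hu : u ≤ ⌊V * Real.log Q⌋₊) : Real.exp (s * u / V) ≤ Q ^ s := by
  have h0 : 0 ≤ V * Real.log Q := mul_nonneg hV.le (Real.log_nonneg hQ)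
  have h1 : (u : ℝ) ≤ V * Real.log Q := (Nat.cast_le.mpr hu).trans (Nat.floor_le h0)
  rw [Real.rpow_def_of_pos (by linarith), Real.exp_le_exp]
  have h2 : (u : ℝ) / V ≤ Real.log Q := by
    rw [div_le_iff₀ hV]; linarith
  calc s * u / V = s * (u / V) := by ring
    _ ≤ s * Real.log Q := mul_le_mul_of_nonneg_left h2 hs
    _ = Real.log Q * s := mul_comm _ _

/-- **One parity class of one block**: the unit intervals `n` (of parity `r`) carrying a point where
`|Q_{u,1}(1+it)| > e^{-αu/V}` number at most
`576 e^{2αu/V} T'^{2α} exp(16 (V log T'/u) log log T')` (Lemma 8 at well-spaced witnesses, with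
`P = e^{u/V}`, `V₈ = e^{αu/V}`, `log V₈/log P = α`). [cite: Lichtman2020, §5.1, (5.10)] -/
theorem card_badClass_le {c : ℕ → ℂ} (hc : ∀ p, ‖c p‖ ≤ 1) {P₁ Q₁ V α : ℝ} (hV : 2 ≤ V)
    (hα : 0 < α) {u : ℕ} (Nmax : ℕ) (hu2 : 2 ≤ Real.exp (u / V))
    (huT : Real.exp (u / V) ≤ (Nmax : ℝ) + 1) (hTe : Real.exp (Real.exp 1) ≤ (Nmax : ℝ) + 1)
    (B : Finset ℕ) (hB : ∀ n ∈ B, n ≤ Nmax ∧ ∃ t ∈ Set.Icc (n : ℝ) (n + 1),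
      Real.exp (-(α * u / V)) < ‖blockPrimePoly c P₁ Q₁ V u t‖) (r : ℕ) :
    (#(B.filter (fun k => k % 2 = r)) : ℝ) ≤
      576 * Real.exp (2 * α * u / V) * ((Nmax : ℝ) + 1) ^ (2 * α) *
        Real.exp (16 * (V * Real.log ((Nmax : ℝ) + 1) / u) * Real.log (Real.log ((Nmax : ℝ) + 1))) := by
  classical
  set T' : ℝ := (Nmax : ℝ) + 1 with hT'def
  have hV0 : 0 < V := by linarith
  -- witnesses
  have hex : ∀ n, ∃ t : ℝ, n ∈ B → (t ∈ Set.Icc (n : ℝ) (n + 1) ∧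
      Real.exp (-(α * u / V)) < ‖blockPrimePoly c P₁ Q₁ V u t‖) := by
    intro n
    by_cases hn : n ∈ B
    · obtain ⟨-, t, ht, hlt⟩ := hB n hn
      exact ⟨t, fun _ => ⟨ht, hlt⟩⟩
    · exact ⟨n, fun h => absurd h hn⟩
  choose ssel hssel using hex
  have ht : ∀ n ∈ B, (n : ℝ) ≤ ssel n ∧ ssel n ≤ n + 1 := fun n hn => (hssel n hn).1
  obtain ⟨hws, hcardW, -⟩ := parity_image_facts ht r (fun _ => (0 : ℝ))
  rw [← hcardW]
  set 𝒲 := (B.filter (fun k => k % 2 = r)).image ssel with h𝒲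
  -- Lemma 8 data
  set Pd : ℝ := Real.exp (u / V) with hPd
  set V₈ : ℝ := Real.exp (α * u / V) with hV₈
  have hu0 : (0 : ℝ) < u := by
    by_contra h
    push Not at h
    have : (u : ℝ) = 0 := le_antisymm h (Nat.cast_nonneg u)
    rw [hPd, this, zero_div, Real.exp_zero] at hu2
    linarith
  have hV₈1 : 1 ≤ V₈ := Real.one_le_exp (by positivity)
  have hlogPd : Real.log Pd = u / V := Real.log_exp _
  have hlogV₈ : Real.log V₈ = α * u / V := Real.log_exp _
  have ha : ∀ p, ‖(if p ∈ primeBlock P₁ Q₁ V u then c p else 0)‖ ≤ 1 := fun p => by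
    split_ifs
    · exact hc p
    · simp
  have h𝒲T : ∀ t ∈ 𝒲, |t| ≤ T' := by
    intro t ht'
    rw [h𝒲, Finset.mem_image] at ht'
    obtain ⟨n, hn, rfl⟩ := ht'
    rw [Finset.mem_filter] at hn
    obtain ⟨h1, h2⟩ := ht n hn.1
    have hn0 : (0 : ℝ) ≤ n := Nat.cast_nonneg n
    have hnN : (n : ℝ) ≤ Nmax := by exact_mod_cast (hB n hn.1).1
    rw [abs_of_nonneg (by linarith)]
    simp only [hT'def]; linarith
  have hlarge : ∀ t ∈ 𝒲, V₈⁻¹ ≤ ‖∑ p ∈ (Icc ⌈Pd⌉₊ ⌊2 * Pd⌋₊).filter Nat.Prime,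
      (if p ∈ primeBlock P₁ Q₁ V u then c p else 0) * (p : ℂ) ^ (-(1 + (t : ℂ) * I))‖ := by
    intro t ht'
    rw [h𝒲, Finset.mem_image] at ht'
    obtain ⟨n, hn, rfl⟩ := ht'
    rw [Finset.mem_filter] at hn
    have hlt := (hssel n hn.1).2
    rw [hPd, ← blockPrimePoly_eq_dyadic c hV u]
    rw [hV₈, ← Real.exp_neg]
    exact hlt.le
  have key := card_largeValues_primePoly_le Pd T' V₈ _ 𝒲 hu2 huT hTe hV₈1 ha h𝒲T hws hlarge
  refine key.trans (le_of_eq ?_)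
  rw [hlogV₈, hlogPd]
  have hV₈2 : V₈ ^ 2 = Real.exp (2 * α * u / V) := by
    rw [hV₈, ← Real.exp_nat_mul]; congr 1; push_cast; ring
  have hexp : 2 * (α * u / V) / (u / V) = 2 * α := by field_simp
  have hrat : Real.log T' / (u / V) = V * Real.log T' / u := by field_simp
  rw [hV₈2, hexp, hrat]

/-- **The count of the bad intervals** ((5.10), p. 15): a finite set `B` of unit intervals
`n ≤ N_max`, each carrying some `t ∈ [n, n+1]` and `u ∈ ℐ₁ = [v₀, v₁]` with `|Q_{u,1}(1+it)| > e^{-αu/V}`, has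
`#B ≤ #ℐ₁ · 1152 · Q₁^{2α} T'^{2α} exp(16 (V log T'/v₀) log log T')` (`T' = N_max + 1 ≥ e^e`,
`2 ≤ e^{u/V} ≤ T'` on `ℐ₁`, `v₀ ≥ 1`, `v₁ = ⌊V log Q₁⌋`). [cite: Lichtman2020, §5.1, (5.10)] -/
theorem card_bad_le {c : ℕ → ℂ} (hc : ∀ p, ‖c p‖ ≤ 1) {P₁ Q₁ V α : ℝ} (hV : 2 ≤ V) (hα : 0 < α)
    (hQ₁ : 1 ≤ Q₁) {v₀ : ℕ} (hv₀ : 1 ≤ v₀) (Nmax : ℕ) (hTe : Real.exp (Real.exp 1) ≤ (Nmax : ℝ) + 1)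
    (hblocks : ∀ u ∈ Icc v₀ ⌊V * Real.log Q₁⌋₊, 2 ≤ Real.exp (u / V) ∧ Real.exp (u / V) ≤ (Nmax : ℝ) + 1)
    (B : Finset ℕ) (hB : ∀ n ∈ B, n ≤ Nmax ∧ ∃ t ∈ Set.Icc (n : ℝ) (n + 1),
      ∃ u ∈ Icc v₀ ⌊V * Real.log Q₁⌋₊, Real.exp (-(α * u / V)) < ‖blockPrimePoly c P₁ Q₁ V u t‖) :
    (#B : ℝ) ≤ #(Icc v₀ ⌊V * Real.log Q₁⌋₊) * (1152 * Q₁ ^ (2 * α) * ((Nmax : ℝ) + 1) ^ (2 * α) *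
        Real.exp (16 * (V * Real.log ((Nmax : ℝ) + 1) / v₀) * Real.log (Real.log ((Nmax : ℝ) + 1)))) := by
  classical
  set T' : ℝ := (Nmax : ℝ) + 1 with hT'def
  set ℐ := Icc v₀ ⌊V * Real.log Q₁⌋₊ with hℐ
  have hV0 : 0 < V := by linarith
  -- `B ⊆ ⋃_u Bad_u`
  set Bad : ℕ → Finset ℕ := fun u => B.filter (fun n => ∃ t ∈ Set.Icc (n : ℝ) (n + 1),
    Real.exp (-(α * u / V)) < ‖blockPrimePoly c P₁ Q₁ V u t‖) with hBad
  have hsub : B ⊆ ℐ.biUnion Bad := by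
    intro n hn
    obtain ⟨-, t, ht, u, hu, hlt⟩ := hB n hn
    rw [Finset.mem_biUnion]
    exact ⟨u, hu, Finset.mem_filter.mpr ⟨hn, t, ht, hlt⟩⟩
  have h1 : (#B : ℝ) ≤ ∑ u ∈ ℐ, (#(Bad u) : ℝ) := by
    have := (Finset.card_le_card hsub).trans Finset.card_biUnion_le
    exact_mod_cast this
  refine h1.trans ?_
  rw [← nsmul_eq_mul, ← Finset.sum_const]
  refine Finset.sum_le_sum fun u hu => ?_
  -- one block: two parity classes
  obtain ⟨hu2, huT⟩ := hblocks u hu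
  have hBu : ∀ n ∈ Bad u, n ≤ Nmax ∧ ∃ t ∈ Set.Icc (n : ℝ) (n + 1),
      Real.exp (-(α * u / V)) < ‖blockPrimePoly c P₁ Q₁ V u t‖ := by
    intro n hn
    rw [hBad, Finset.mem_filter] at hn
    exact ⟨(hB n hn.1).1, hn.2⟩
  have hcl := fun r => card_badClass_le hc hV hα Nmax hu2 huT hTe (Bad u) hBu r
  have hsplit : (#(Bad u) : ℝ) = #((Bad u).filter (fun k => k % 2 = 0)) + #((Bad u).filter (fun k => k % 2 = 1)) := by
    have := Finset.card_filter_add_card_filter_not (s := Bad u) (fun k => k % 2 = 0)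
    have e : (Bad u).filter (fun k => ¬ k % 2 = 0) = (Bad u).filter (fun k => k % 2 = 1) := by
      ext k; simp
    rw [e] at this
    exact_mod_cast this.symm
  rw [hsplit]
  refine (add_le_add (hcl 0) (hcl 1)).trans ?_
  -- `e^{2αu/V} ≤ Q₁^{2α}` and `1/u ≤ 1/v₀`
  have hmem := Finset.mem_Icc.mp hu
  have he1 : Real.exp (2 * α * u / V) ≤ Q₁ ^ (2 * α) :=
    exp_mul_div_le_rpow hV0 hQ₁ (by positivity) hmem.2
  have hu0 : (0 : ℝ) < u := by exact_mod_cast (show 0 < u by omega)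
  have hv₀0 : (0 : ℝ) < v₀ := by exact_mod_cast (show 0 < v₀ by omega)
  have hTe1 : Real.exp 1 ≤ Real.log T' := by
    rw [← Real.log_exp (Real.exp 1)]; exact Real.log_le_log (Real.exp_pos _) hTe
  have he0 : 1 ≤ Real.exp 1 := by have := Real.add_one_le_exp (1:ℝ); linarith
  have hlogT : 0 ≤ Real.log T' := by linarith
  have hllT : 0 ≤ Real.log (Real.log T') := Real.log_nonneg (by linarith)
  have he2 : Real.exp (16 * (V * Real.log T' / u) * Real.log (Real.log T')) ≤
      Real.exp (16 * (V * Real.log T' / v₀) * Real.log (Real.log T')) := by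
    rw [Real.exp_le_exp]
    have : V * Real.log T' / u ≤ V * Real.log T' / v₀ := by
      apply div_le_div_of_nonneg_left (by positivity) hv₀0
      exact_mod_cast hmem.1
    have h16 : 0 ≤ Real.log (Real.log T') := hllT
    nlinarith
  have hT'0 : 0 ≤ T' ^ (2 * α) := Real.rpow_nonneg (by positivity) _
  set E := Real.exp (16 * (V * Real.log T' / v₀) * Real.log (Real.log T')) with hE
  have hE0 : 0 ≤ E := (Real.exp_pos _).le
  have hone : 576 * Real.exp (2 * α * u / V) * T' ^ (2 * α) *
      Real.exp (16 * (V * Real.log T' / u) * Real.log (Real.log T')) ≤ 576 * Q₁ ^ (2 * α) * T' ^ (2 * α) * E := by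
    gcongr
  linarith

end Literature.NumberTheory.Sieve.Lichtman2020

namespace Literature.NumberTheory.Sieve.Lichtman2020

/-! ### The main inequality at fixed parameters -/

/-- Continuity of `t ↦ |Q_v(1+it) R_v(1+it)|²`. [folklore] -/
theorem continuous_norm_sq_QR (c b : ℕ → ℂ) (X P Q H : ℝ) (v : ℕ) :
    Continuous fun t : ℝ => ‖blockPrimePoly c P Q H v t * blockCofactorPoly b X P Q H v t‖ ^ 2 :=
  ((continuous_blockPrimePoly c P Q H v).mul (continuous_blockCofactorPoly b X P Q H v)).norm.pow 2

/-- Continuity of `t ↦ |G(1+it)|²`. [folklore] -/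
theorem continuous_norm_sq_G (S : ℕ → Prop) [DecidablePred S] {q : ℕ} (χ : DirichletCharacter ℂ q)
    (R : Finset ℕ) :
    Continuous fun t : ℝ => ‖∑ n ∈ R.filter S, ((ArithmeticFunction.liouville n : ℤ) : ℂ) *
      χ (n : ZMod q) * (n : ℂ) ^ (-(1 + (t : ℂ) * I))‖ ^ 2 :=
  (MatomakiRadziwillLemma12.continuous_dsum (R.filter S) (fun n => ((ArithmeticFunction.liouville n : ℤ) : ℂ) *
    χ (n : ZMod q))).norm.pow 2

set_option maxHeartbeats 1600000 in
-- the §5.1 assembly at fixed parameters: one long bookkeeping proof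
/-- **Proposition 5.1 at fixed parameters** (the assembly of §5.1, pp. 14–15, discretised): for
`S = {n : n has a prime factor in [P₁,Q₁] and one in [P₂,Q₂]}` (`1 ≤ P₁ ≤ Q₁ < P₂ ≤ Q₂`),
`G(1+it) = ∑_{Y ≤ n ≤ 2Y, n ∈ S} λ(n)χ(n)n^{-1-it}`, `0 ≤ T₀ ≤ T`, `T' = ⌊T⌋ + 1`, block fineness
`V ≥ 2`, threshold exponent `α > 0`:
if `|Q_{v,2}(1+it)| ≤ U` on the unit intervals of `[⌊T₀⌋, T']` (Lemma 4.5), the second-interval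
cofactor windows are nonempty, and every set `B` of bad unit intervals (carrying a large value
`|Q_{u,1}| > e^{-αu/V}`) satisfies `#B √T' ≤ ⌈Y e^{-v/V}⌉` ((5.10)), then
`∫_{T₀}^{T} |G|² ≤ C₁₂⁺ [V log(Q₁/P₁) e^{2α/V} P₁^{-2α} (1 + V/2α)(10 Q₁T'/Y + 72) + (T'+Y)/Y (1/V + 1/P₁)]
  + C₁₂⁺ [V log(Q₂/P₂) #ℐ₂ · 10 C₉⁺ U² log(2T') + (T'+Y)/Y (1/V + 1/P₂)]`
(Lemma 12 on the good intervals with `[P₁,Q₁]` and `E₁` by the mean value theorem; Lemma 12 on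
the bad intervals with `[P₂,Q₂]` and `E₂` by Halász–Montgomery at the maximisers).
[cite: Lichtman2020, Proposition 5.1 and §5.1] -/
theorem prop51_fixed {C₁₂ C₉ : ℝ} (h12 : Lemma12With C₁₂) (h9 : Lemma9With C₉)
    {q : ℕ} (χ : DirichletCharacter ℂ q) {Y T T₀ P₁ Q₁ P₂ Q₂ V α U : ℝ}
    (hY : 1 ≤ Y) (hT₀ : 0 ≤ T₀) (hT₀T : T₀ ≤ T) (hP₁ : 1 ≤ P₁) (hPQ₁ : P₁ ≤ Q₁) (hP₂ : 1 ≤ P₂)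
    (hPQ₂ : P₂ ≤ Q₂) (hQP : Q₁ < P₂) (hV : 2 ≤ V) (hα : 0 < α)
    (hUQ : ∀ v ∈ Icc ⌊V * Real.log P₂⌋₊ ⌊V * Real.log Q₂⌋₊, ∀ n ∈ Finset.Ico ⌊T₀⌋₊ (⌊T⌋₊ + 1),
        ∀ t ∈ Set.Icc (n : ℝ) (n + 1), ‖blockPrimePoly (lamChi χ) P₂ Q₂ V v t‖ ≤ U)
    (hN1 : ∀ v ∈ Icc ⌊V * Real.log P₂⌋₊ ⌊V * Real.log Q₂⌋₊, 1 ≤ ⌊2 * Y * Real.exp (-(v / V))⌋₊)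
    (hcardB : ∀ B : Finset ℕ, B ⊆ Finset.Ico ⌊T₀⌋₊ (⌊T⌋₊ + 1) →
        (∀ n ∈ B, ∃ t ∈ Set.Icc (n : ℝ) (n + 1), ∃ u ∈ Icc ⌊V * Real.log P₁⌋₊ ⌊V * Real.log Q₁⌋₊,
            Real.exp (-(α * u / V)) < ‖blockPrimePoly (lamChi χ) P₁ Q₁ V u t‖) →
        ∀ v ∈ Icc ⌊V * Real.log P₂⌋₊ ⌊V * Real.log Q₂⌋₊,
          (#B : ℝ) * Real.sqrt ((⌊T⌋₊ : ℝ) + 1) ≤ ⌈Y * Real.exp (-(v / V))⌉₊) :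
    ∫ t in T₀..T, ‖∑ n ∈ (Icc ⌈Y⌉₊ ⌊2 * Y⌋₊).filter
        (fun n => HasPrimeFactorIn P₁ Q₁ n ∧ HasPrimeFactorIn P₂ Q₂ n),
        ((ArithmeticFunction.liouville n : ℤ) : ℂ) * χ (n : ZMod q) * (n : ℂ) ^ (-(1 + (t : ℂ) * I))‖ ^ 2 ≤
      max C₁₂ 0 * ((V * Real.log (Q₁ / P₁)) * (Real.exp (2 * α / V) * P₁ ^ (-(2 * α)) *
            (1 + V / (2 * α)) * (10 * Q₁ * (((⌊T⌋₊ : ℕ) : ℝ) + 1) / Y + 72))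
          + ((((⌊T⌋₊ : ℕ) : ℝ) + 1) + Y) / Y * (1 / V + 1 / P₁))
      + max C₁₂ 0 * ((V * Real.log (Q₂ / P₂)) * (#(Icc ⌊V * Real.log P₂⌋₊ ⌊V * Real.log Q₂⌋₊) *
            (10 * max C₉ 0 * U ^ 2 * Real.log (2 * ((((⌊T⌋₊ : ℕ) : ℝ)) + 1))))
          + ((((⌊T⌋₊ : ℕ) : ℝ) + 1) + Y) / Y * (1 / V + 1 / P₂)) := by
  classical
  set Nmax := ⌊T⌋₊ with hNmax
  set T' : ℝ := (Nmax : ℝ) + 1 with hT'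
  set 𝒩 := Finset.Ico ⌊T₀⌋₊ (Nmax + 1) with h𝒩
  set ℐ₁ := Icc ⌊V * Real.log P₁⌋₊ ⌊V * Real.log Q₁⌋₊ with hℐ₁
  set ℐ₂ := Icc ⌊V * Real.log P₂⌋₊ ⌊V * Real.log Q₂⌋₊ with hℐ₂
  set S : ℕ → Prop := fun n => HasPrimeFactorIn P₁ Q₁ n ∧ HasPrimeFactorIn P₂ Q₂ n with hS
  set f : ℝ → ℝ := fun t => ‖∑ n ∈ (Icc ⌈Y⌉₊ ⌊2 * Y⌋₊).filter S,
    ((ArithmeticFunction.liouville n : ℤ) : ℂ) * χ (n : ZMod q) * (n : ℂ) ^ (-(1 + (t : ℂ) * I))‖ ^ 2 with hf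
  have hfc : Continuous f := continuous_norm_sq_G S χ _
  have hf0 : ∀ t, 0 ≤ f t := fun t => by positivity
  have hY0 : 0 < Y := by linarith
  have hV0 : 0 < V := by linarith
  have hV1 : 1 ≤ V := by linarith
  have hT'1 : 1 ≤ T' := by simp [hT']
  have hT'0 : 0 < T' := by linarith
  have hQ₁ : 1 ≤ Q₁ := by linarith
  have hC₁₂ : 0 ≤ max C₁₂ 0 := le_max_right _ _
  have hC₉ : 0 ≤ max C₉ 0 := le_max_right _ _
  -- good and bad unit intervals
  set good : ℕ → Prop := fun n => ∀ t ∈ Set.Icc (n : ℝ) (n + 1), ∀ v ∈ ℐ₁,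
    ‖blockPrimePoly (lamChi χ) P₁ Q₁ V v t‖ ≤ Real.exp (-(α * v / V)) with hgood
  set G := 𝒩.filter good with hG
  set B := 𝒩.filter (fun n => ¬ good n) with hB
  have hGN : ∀ n ∈ G, n ≤ Nmax := fun n hn => by
    have := (Finset.mem_Ico.mp (Finset.mem_filter.mp hn).1).2; omega
  have hBN : ∀ n ∈ B, n ≤ Nmax := fun n hn => by
    have := (Finset.mem_Ico.mp (Finset.mem_filter.mp hn).1).2; omega
  have hsubI : ∀ (F : Finset ℕ), (∀ n ∈ F, n ≤ Nmax) → unitUnion F ⊆ Set.Icc (-T') T' := by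
    intro F hF t ht
    obtain ⟨n, hn, h1, h2⟩ := exists_mem_of_mem_unitUnion ht
    have hn0 : (0 : ℝ) ≤ n := Nat.cast_nonneg n
    have hnN : (n : ℝ) ≤ Nmax := by exact_mod_cast hF n hn
    constructor <;> [skip; skip] <;> simp only [hT'] <;> linarith
  -- Step 1: discretise and split
  have step1 : ∫ t in T₀..T, f t ≤ (∑ n ∈ G, ∫ t in (n : ℝ)..((n + 1 : ℕ) : ℝ), f t)
      + ∑ n ∈ B, ∫ t in (n : ℝ)..((n + 1 : ℕ) : ℝ), f t := by
    refine (intervalIntegral_le_sum_unit hfc hf0 hT₀ hT₀T).trans (le_of_eq ?_)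
    rw [hG, hB, Finset.sum_filter_add_sum_filter_not]
  -- Step 2: the good part
  have hdisj₁ : ∀ p : ℕ, P₁ ≤ p → (p : ℝ) ≤ Q₁ → ¬ (P₂ ≤ p ∧ (p : ℝ) ≤ Q₂) :=
    fun p _ h2 h => by linarith [h.1]
  have hdisj₂ : ∀ p : ℕ, P₂ ≤ p → (p : ℝ) ≤ Q₂ → ¬ (P₁ ≤ p ∧ (p : ℝ) ≤ Q₁) :=
    fun p h1 _ h => by linarith [h.2]
  have goodPart : ∑ n ∈ G, ∫ t in (n : ℝ)..((n + 1 : ℕ) : ℝ), f t ≤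
      max C₁₂ 0 * ((V * Real.log (Q₁ / P₁)) * (Real.exp (2 * α / V) * P₁ ^ (-(2 * α)) *
        (1 + V / (2 * α)) * (10 * Q₁ * T' / Y + 72)) + (T' + Y) / Y * (1 / V + 1 / P₁)) := by
    rw [← setIntegral_unitUnion hfc G]
    have hL := ramare_first h12 hY hT'1 hP₁ hPQ₁ hV1 hdisj₁ χ (measurableSet_unitUnion G) (hsubI G hGN)
    refine hL.trans ?_
    -- the block integrals over the good intervals
    have hblocks : ∑ v ∈ ℐ₁, ∫ t in unitUnion G, ‖blockPrimePoly (lamChi χ) P₁ Q₁ V v t *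
        blockCofactorPoly (lamChiOn (HasPrimeFactorIn P₂ Q₂) χ) Y P₁ Q₁ V v t‖ ^ 2 ≤
        Real.exp (2 * α / V) * P₁ ^ (-(2 * α)) * (1 + V / (2 * α)) * (10 * Q₁ * T' / Y + 72) := by
      have e : ∀ v, ∫ t in unitUnion G, ‖blockPrimePoly (lamChi χ) P₁ Q₁ V v t *
          blockCofactorPoly (lamChiOn (HasPrimeFactorIn P₂ Q₂) χ) Y P₁ Q₁ V v t‖ ^ 2 =
          ∑ n ∈ G, ∫ t in (n : ℝ)..((n + 1 : ℕ) : ℝ), ‖blockPrimePoly (lamChi χ) P₁ Q₁ V v t *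
            blockCofactorPoly (lamChiOn (HasPrimeFactorIn P₂ Q₂) χ) Y P₁ Q₁ V v t‖ ^ 2 :=
        fun v => setIntegral_unitUnion (continuous_norm_sq_QR _ _ _ _ _ _ v) G
      simp_rw [e]
      refine E1_sum (c := lamChi χ) (norm_lamChiOn_le _ χ) hY0 hP₁ hQ₁ hV0 hα Nmax G hGN ?_
      intro n hn t ht v hv
      exact (Finset.mem_filter.mp hn).2 t ht v hv
    have hlog : 0 ≤ Real.log (Q₁ / P₁) := Real.log_nonneg (by rw [le_div_iff₀ (by linarith)]; linarith)
    have hS0 : 0 ≤ ∑ v ∈ ℐ₁, ∫ t in unitUnion G, ‖blockPrimePoly (lamChi χ) P₁ Q₁ V v t *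
        blockCofactorPoly (lamChiOn (HasPrimeFactorIn P₂ Q₂) χ) Y P₁ Q₁ V v t‖ ^ 2 :=
      Finset.sum_nonneg fun v _ => setIntegral_nonneg (measurableSet_unitUnion G) fun t _ => by positivity
    have herr0 : 0 ≤ (T' + Y) / Y * (1 / V + 1 / P₁) := by positivity
    have hVlog : 0 ≤ V * Real.log (Q₁ / P₁) := mul_nonneg hV0.le hlog
    have hstuff0 : 0 ≤ (V * Real.log (Q₁ / P₁)) * (∑ v ∈ ℐ₁, ∫ t in unitUnion G,
        ‖blockPrimePoly (lamChi χ) P₁ Q₁ V v t *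
          blockCofactorPoly (lamChiOn (HasPrimeFactorIn P₂ Q₂) χ) Y P₁ Q₁ V v t‖ ^ 2)
        + (T' + Y) / Y * (1 / V + 1 / P₁) := by positivity
    calc C₁₂ * ((V * Real.log (Q₁ / P₁)) * (∑ v ∈ ℐ₁, ∫ t in unitUnion G,
          ‖blockPrimePoly (lamChi χ) P₁ Q₁ V v t *
            blockCofactorPoly (lamChiOn (HasPrimeFactorIn P₂ Q₂) χ) Y P₁ Q₁ V v t‖ ^ 2)
          + (T' + Y) / Y * (1 / V + 1 / P₁))
        ≤ max C₁₂ 0 * ((V * Real.log (Q₁ / P₁)) * (∑ v ∈ ℐ₁, ∫ t in unitUnion G,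
          ‖blockPrimePoly (lamChi χ) P₁ Q₁ V v t *
            blockCofactorPoly (lamChiOn (HasPrimeFactorIn P₂ Q₂) χ) Y P₁ Q₁ V v t‖ ^ 2)
          + (T' + Y) / Y * (1 / V + 1 / P₁)) :=
          mul_le_mul_of_nonneg_right (le_max_left _ _) hstuff0
      _ ≤ _ := by
          refine mul_le_mul_of_nonneg_left ?_ hC₁₂
          exact add_le_add (mul_le_mul_of_nonneg_left hblocks hVlog) le_rfl
  -- Step 3: the bad part
  have badPart : ∑ n ∈ B, ∫ t in (n : ℝ)..((n + 1 : ℕ) : ℝ), f t ≤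
      max C₁₂ 0 * ((V * Real.log (Q₂ / P₂)) * (#ℐ₂ * (10 * max C₉ 0 * U ^ 2 * Real.log (2 * T')))
        + (T' + Y) / Y * (1 / V + 1 / P₂)) := by
    rw [← setIntegral_unitUnion hfc B]
    have hL := ramare_second h12 hY hT'1 hP₂ hPQ₂ hV1 hdisj₂ χ (measurableSet_unitUnion B) (hsubI B hBN)
    refine hL.trans ?_
    have hbadprop : ∀ n ∈ B, ∃ t ∈ Set.Icc (n : ℝ) (n + 1), ∃ u ∈ ℐ₁,
        Real.exp (-(α * u / V)) < ‖blockPrimePoly (lamChi χ) P₁ Q₁ V u t‖ := by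
      intro n hn
      have h := (Finset.mem_filter.mp hn).2
      simp only [hgood, not_forall, not_le, exists_prop] at h
      obtain ⟨t, ht, u, hu, hlt⟩ := h
      exact ⟨t, ht, u, hu, hlt⟩
    have hBsub : B ⊆ 𝒩 := Finset.filter_subset _ _
    have hblocks : ∑ v ∈ ℐ₂, ∫ t in unitUnion B, ‖blockPrimePoly (lamChi χ) P₂ Q₂ V v t *
        blockCofactorPoly (lamChiOn (HasPrimeFactorIn P₁ Q₁) χ) Y P₂ Q₂ V v t‖ ^ 2 ≤
        #ℐ₂ * (10 * max C₉ 0 * U ^ 2 * Real.log (2 * T')) := by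
      rw [← nsmul_eq_mul, ← Finset.sum_const]
      refine Finset.sum_le_sum fun v hv => ?_
      rw [setIntegral_unitUnion (continuous_norm_sq_QR _ _ _ _ _ _ v) B]
      refine E2_block h9 (c := lamChi χ) (norm_lamChiOn_le _ χ) hY0 v Nmax B hBN (hN1 v hv)
        (hcardB B hBsub hbadprop v hv) ?_
      intro n hn t ht
      exact hUQ v hv n (hBsub hn) t ht
    have hlog : 0 ≤ Real.log (Q₂ / P₂) := Real.log_nonneg (by rw [le_div_iff₀ (by linarith)]; linarith)
    have hS0 : 0 ≤ ∑ v ∈ ℐ₂, ∫ t in unitUnion B, ‖blockPrimePoly (lamChi χ) P₂ Q₂ V v t *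
        blockCofactorPoly (lamChiOn (HasPrimeFactorIn P₁ Q₁) χ) Y P₂ Q₂ V v t‖ ^ 2 :=
      Finset.sum_nonneg fun v _ => setIntegral_nonneg (measurableSet_unitUnion B) fun t _ => by positivity
    have hVlog : 0 ≤ V * Real.log (Q₂ / P₂) := mul_nonneg hV0.le hlog
    have hstuff0 : 0 ≤ (V * Real.log (Q₂ / P₂)) * (∑ v ∈ ℐ₂, ∫ t in unitUnion B,
        ‖blockPrimePoly (lamChi χ) P₂ Q₂ V v t *
          blockCofactorPoly (lamChiOn (HasPrimeFactorIn P₁ Q₁) χ) Y P₂ Q₂ V v t‖ ^ 2)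
        + (T' + Y) / Y * (1 / V + 1 / P₂) := by positivity
    calc C₁₂ * ((V * Real.log (Q₂ / P₂)) * (∑ v ∈ ℐ₂, ∫ t in unitUnion B,
          ‖blockPrimePoly (lamChi χ) P₂ Q₂ V v t *
            blockCofactorPoly (lamChiOn (HasPrimeFactorIn P₁ Q₁) χ) Y P₂ Q₂ V v t‖ ^ 2)
          + (T' + Y) / Y * (1 / V + 1 / P₂))
        ≤ max C₁₂ 0 * ((V * Real.log (Q₂ / P₂)) * (∑ v ∈ ℐ₂, ∫ t in unitUnion B,
          ‖blockPrimePoly (lamChi χ) P₂ Q₂ V v t *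
            blockCofactorPoly (lamChiOn (HasPrimeFactorIn P₁ Q₁) χ) Y P₂ Q₂ V v t‖ ^ 2)
          + (T' + Y) / Y * (1 / V + 1 / P₂)) :=
          mul_le_mul_of_nonneg_right (le_max_left _ _) hstuff0
      _ ≤ _ := by
          refine mul_le_mul_of_nonneg_left ?_ hC₁₂
          exact add_le_add (mul_le_mul_of_nonneg_left hblocks hVlog) le_rfl
  -- conclusion
  have := step1.trans (add_le_add goodPart badPart)
  simpa only [hT'] using this

end Literature.NumberTheory.Sieve.Lichtman2020

namespace Literature.NumberTheory.Sieve.Lichtman2020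

/-- The filter by `lichtmanTypicalWith` is the filter by the conjunction of the two factor conditions. [folklore] -/
theorem filter_lichtmanTypicalWith (c X A δ H : ℝ) (R : Finset ℕ) :
    R.filter (lichtmanTypicalWith c X A δ H) =
      R.filter (fun n => HasPrimeFactorIn (Real.log X ^ (c * A)) (H / Real.log X ^ (4 * A)) n ∧
        HasPrimeFactorIn (Real.exp (Real.log X ^ (2 / 3 + δ / 2)))
          (Real.exp (Real.log X ^ (1 - δ / 2))) n) := by
  ext n
  simp only [Finset.mem_filter, lichtmanTypicalWith]

/-! ### Elementary facts at a large `X` -/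

/-- `X = e^L ≥ e^{64}`: `X ≥ 3`, `X ≥ 1`. [folklore] -/
theorem X_large {X : ℕ} (hL : 64 ≤ Real.log X) : (3 : ℝ) ≤ X ∧ (0 : ℝ) < X := by
  have hX0 : (0 : ℝ) < X := by
    by_contra h
    push Not at h
    have : (X : ℝ) = 0 := le_antisymm h (Nat.cast_nonneg X)
    rw [this, Real.log_zero] at hL
    linarith
  refine ⟨?_, hX0⟩
  have h1 : Real.exp 64 ≤ X := by
    rw [← Real.exp_log hX0]; exact Real.exp_le_exp.mpr hL
  have h2 : (64 : ℝ) + 1 ≤ Real.exp 64 := Real.add_one_le_exp 64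
  linarith

/-- `log 3 ≤ 2`, `log 2 ≤ 1`. [folklore] -/
theorem log_three_le_two : Real.log 3 ≤ 2 ∧ Real.log 2 ≤ 1 := by
  constructor
  · have := Real.log_le_sub_one_of_pos (show (0:ℝ) < 3 by norm_num); linarith
  · have := Real.log_le_sub_one_of_pos (show (0:ℝ) < 2 by norm_num); linarith

/-- For `v ≤ ⌊H log Q⌋` (`Q ≥ 1`, `H > 0`, `X ≥ 0`): `X/Q ≤ X e^{-v/H}`. [folklore] -/
theorem div_le_mul_exp_neg {X H Q : ℝ} (hX : 0 ≤ X) (hH : 0 < H) (hQ : 1 ≤ Q) {v : ℕ}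
    (hv : v ≤ ⌊H * Real.log Q⌋₊) : X / Q ≤ X * Real.exp (-(v / H)) := by
  have hQ0 : 0 < Q := by linarith
  have h0 : 0 ≤ H * Real.log Q := mul_nonneg hH.le (Real.log_nonneg hQ)
  have h1 : (v : ℝ) ≤ Real.log Q * H := by
    calc (v : ℝ) ≤ H * Real.log Q := (Nat.cast_le.mpr hv).trans (Nat.floor_le h0)
      _ = Real.log Q * H := mul_comm _ _
  have h2 : 1 / Q ≤ Real.exp (-(v / H)) := by
    have e : 1 / Q = Real.exp (-Real.log Q) := by
      rw [Real.exp_neg, Real.exp_log hQ0, one_div]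
    rw [e, Real.exp_le_exp, neg_le_neg_iff, div_le_iff₀ hH]
    exact h1
  calc X / Q = X * (1 / Q) := by ring
    _ ≤ X * Real.exp (-(v / H)) := mul_le_mul_of_nonneg_left h2 hX

/-! ### The bound `U` for `Q_{v,2}` from Lemma 4.5 (at scale `X²`) -/

/-- **(5.9)**: on the unit intervals above `T₀ = L^{22A}` (`L = log X`), `|Q_{v,2}(1+it)| ≤ 3 C₄₅⁺ L^{1-22A}`,
by Lemma 4.5 at scale `X' = X²` with `K = 22A` (`t ≤ 2X + 1 ≤ X²`, `q ≤ L^A ≤ (2L)^A`,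
`P₂ ≥ exp((2L)^θ)`). [cite: Lichtman2020, (5.9)] -/
theorem UQ_bound {C₄₅ A θ : ℝ} {X : ℕ}
    (h45 : ∀ q : ℕ, 1 ≤ q → (q : ℝ) ≤ Real.log ((X : ℝ) ^ 2) ^ A → ∀ χ : DirichletCharacter ℂ q,
      ∀ P Q : ℝ, Real.exp (Real.log ((X : ℝ) ^ 2) ^ θ) ≤ P → P ≤ Q → Q ≤ (X : ℝ) ^ 2 → ∀ t : ℝ, |t| ≤ (X : ℝ) ^ 2 →
        ‖∑ p ∈ (Icc ⌈P⌉₊ ⌊Q⌋₊).filter Nat.Prime, χ (p : ZMod q) * (p : ℂ) ^ (-(1 + (t : ℂ) * I))‖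
          ≤ C₄₅ * (Real.log ((X : ℝ) ^ 2) / (1 + |t|) + Real.log ((X : ℝ) ^ 2) ^ (-(22 * A))))
    (hL : 64 ≤ Real.log X) (hA : 0 < A) {q : ℕ} (hq : 1 ≤ q) (hqA : (q : ℝ) ≤ Real.log X ^ A)
    (χ : DirichletCharacter ℂ q) {P₂ Q₂ V T : ℝ}
    (hP₂ : Real.exp ((2 * Real.log X) ^ θ) ≤ P₂) (hQ₂ : Q₂ ≤ X) (hT : T ≤ 2 * X)
    (v : ℕ) {n : ℕ} (hn : n ∈ Finset.Ico ⌊Real.log X ^ (22 * A)⌋₊ (⌊T⌋₊ + 1))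
    {t : ℝ} (ht : t ∈ Set.Icc (n : ℝ) (n + 1)) :
    ‖blockPrimePoly (lamChi χ) P₂ Q₂ V v t‖ ≤ 3 * max C₄₅ 0 * Real.log X ^ (1 - 22 * A) := by
  obtain ⟨hX3, hX0⟩ := X_large hL
  set L := Real.log X with hLdef
  have hL1 : 1 ≤ L := by linarith
  have hL0 : 0 < L := by linarith
  have hlog2 : Real.log ((X : ℝ) ^ 2) = 2 * L := by rw [Real.log_pow]; push_cast; ring
  have hX'1 : (1 : ℝ) ≤ (X : ℝ) ^ 2 := by nlinarith
  -- `t`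
  obtain ⟨ht1, ht2⟩ := ht
  rw [Finset.mem_Ico] at hn
  have hn0 : (0 : ℝ) ≤ n := Nat.cast_nonneg n
  have htT : t ≤ 2 * X + 1 := by
    have h1 : (n : ℝ) ≤ ⌊T⌋₊ := by exact_mod_cast (show n ≤ ⌊T⌋₊ by omega)
    have h2 : (⌊T⌋₊ : ℝ) ≤ 2 * X := by
      rcases le_or_gt 0 T with h | h
      · exact (Nat.floor_le h).trans hT
      · rw [Nat.floor_of_nonpos h.le]; push_cast; positivity
    linarith
  have htabs : |t| = t := abs_of_nonneg (by linarith)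
  have htX : |t| ≤ (X : ℝ) ^ 2 := by rw [htabs]; nlinarith
  have htT₀ : L ^ (22 * A) ≤ 1 + |t| := by
    rw [htabs]
    have h1 : (⌊L ^ (22 * A)⌋₊ : ℝ) ≤ n := by exact_mod_cast hn.1
    have h2 : L ^ (22 * A) < ⌊L ^ (22 * A)⌋₊ + 1 := Nat.lt_floor_add_one _
    linarith
  -- Lemma 4.5 at scale X²
  have hqA' : (q : ℝ) ≤ Real.log ((X : ℝ) ^ 2) ^ A := by
    rw [hlog2]
    exact hqA.trans (Real.rpow_le_rpow hL0.le (by linarith) hA.le)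
  have hP₂' : Real.exp (Real.log ((X : ℝ) ^ 2) ^ θ) ≤ P₂ := by rwa [hlog2]
  have hQ₂' : Q₂ ≤ (X : ℝ) ^ 2 := hQ₂.trans (by nlinarith)
  have key := norm_blockPrimePoly_le_of_L45 (K := 22 * A) h45 hX'1 hq hqA' χ hP₂' hQ₂' (H := V) v htX
  refine key.trans ?_
  rw [hlog2]
  have hD : 0 ≤ max C₄₅ 0 := le_max_right _ _
  have hpow0 : 0 < L ^ (22 * A) := Real.rpow_pos_of_pos hL0 _
  -- `2L/(1+|t|) ≤ 2 L^{1-22A}` and `(2L)^{-22A} ≤ L^{1-22A}`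
  have e1 : L ^ (1 - 22 * A) = L / L ^ (22 * A) := by
    rw [Real.rpow_sub hL0, Real.rpow_one]
  have h1 : 2 * L / (1 + |t|) ≤ 2 * L ^ (1 - 22 * A) := by
    rw [e1, mul_div_assoc]
    refine mul_le_mul_of_nonneg_left ?_ (by norm_num)
    exact div_le_div_of_nonneg_left hL0.le hpow0 htT₀
  have h2 : (2 * L) ^ (-(22 * A)) ≤ L ^ (1 - 22 * A) := by
    have h3 : (2 * L) ^ (-(22 * A)) ≤ L ^ (-(22 * A)) :=
      Real.rpow_le_rpow_of_nonpos hL0 (by linarith) (by linarith)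
    refine h3.trans ?_
    rw [Real.rpow_neg hL0.le, e1, le_div_iff₀ hpow0, inv_mul_cancel₀ hpow0.ne']
    exact hL1
  calc max C₄₅ 0 * (2 * L / (1 + |t|) + (2 * L) ^ (-(22 * A)))
      ≤ max C₄₅ 0 * (2 * L ^ (1 - 22 * A) + L ^ (1 - 22 * A)) := by gcongr
    _ = 3 * max C₄₅ 0 * L ^ (1 - 22 * A) := by ring

/-! ### The count of bad intervals at a large `X` -/

/-- Exponentiating the additive condition: from
`log 2304 + κ log 3 + L^{2/3} + L^{1-δ/2} + (17A+1) log L ≤ (1-κ) L` (`L = log X`), the product bound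
`2304 L^{11A} L exp(L^{2/3}/3) (3X)^κ exp(L^{1-δ/2}) L^{6A} ≤ X`. [folklore] -/
theorem exp_form_F12 {X : ℕ} {κ δ A : ℝ} (hL : 64 ≤ Real.log X)
    (h : Real.log 2304 + κ * Real.log 3 + Real.log X ^ (2 / 3 : ℝ) + Real.log X ^ (1 - δ / 2)
      + (17 * A + 1) * Real.log (Real.log X) ≤ (1 - κ) * Real.log X) :
    2304 * Real.log X ^ (11 * A) * Real.log X * Real.exp (Real.log X ^ (2 / 3 : ℝ) / 3) *
        (3 * (X : ℝ)) ^ κ * Real.exp (Real.log X ^ (1 - δ / 2)) * Real.log X ^ (6 * A) ≤ X := by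
  obtain ⟨hX3, hX0⟩ := X_large hL
  set L := Real.log X with hLdef
  have hL0 : 0 < L := by linarith
  have eX : (X : ℝ) = Real.exp L := (Real.exp_log hX0).symm
  have e2 : L ^ (11 * A) = Real.exp (11 * A * Real.log L) := by
    rw [Real.rpow_def_of_pos hL0]; ring_nf
  have e4 : (3 * (X : ℝ)) ^ κ = Real.exp (κ * (Real.log 3 + L)) := by
    rw [Real.rpow_def_of_pos (by linarith), Real.log_mul (by norm_num) hX0.ne', ← hLdef]; ring_nf
  have e5 : L ^ (6 * A) = Real.exp (6 * A * Real.log L) := by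
    rw [Real.rpow_def_of_pos hL0]; ring_nf
  have eq : 2304 * L ^ (11 * A) * L * Real.exp (L ^ (2 / 3 : ℝ) / 3) *
      (3 * (X : ℝ)) ^ κ * Real.exp (L ^ (1 - δ / 2)) * L ^ (6 * A) =
      Real.exp (Real.log 2304 + 11 * A * Real.log L + Real.log L + L ^ (2 / 3 : ℝ) / 3
        + κ * (Real.log 3 + L) + L ^ (1 - δ / 2) + 6 * A * Real.log L) := by
    rw [Real.exp_add, Real.exp_add, Real.exp_add, Real.exp_add, Real.exp_add, Real.exp_add,
      Real.exp_log (by norm_num : (0 : ℝ) < 2304), Real.exp_log hL0, ← e2, ← e4, ← e5]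
  rw [eq, eX, Real.exp_le_exp]
  have h23 : 0 ≤ L ^ (2 / 3 : ℝ) := Real.rpow_nonneg hL0.le _
  have r1 : (17 * A + 1) * Real.log L = 11 * A * Real.log L + Real.log L + 6 * A * Real.log L := by ring
  have r2 : κ * (Real.log 3 + L) = κ * Real.log 3 + κ * L := by ring
  have r3 : (1 - κ) * L = L - κ * L := by ring
  rw [r1, r3] at h
  rw [r2]
  linarith

/-- From `L^{1-δ/2} + 6A log L ≤ (5/8) L`: `X^{3/8} exp(L^{1-δ/2}) L^{6A} ≤ X`. [folklore] -/
theorem exp_form_F8 {X : ℕ} {δ A : ℝ} (hL : 64 ≤ Real.log X)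
    (h : Real.log X ^ (1 - δ / 2) + 6 * A * Real.log (Real.log X) ≤ 5 / 8 * Real.log X) :
    (X : ℝ) ^ (3 / 8 : ℝ) * Real.exp (Real.log X ^ (1 - δ / 2)) * Real.log X ^ (6 * A) ≤ X := by
  obtain ⟨hX3, hX0⟩ := X_large hL
  set L := Real.log X with hLdef
  have hL0 : 0 < L := by linarith
  have eX : (X : ℝ) = Real.exp L := (Real.exp_log hX0).symm
  have e1 : (X : ℝ) ^ (3 / 8 : ℝ) = Real.exp (3 / 8 * L) := by
    rw [Real.rpow_def_of_pos hX0, ← hLdef]; ring_nf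
  have e5 : L ^ (6 * A) = Real.exp (6 * A * Real.log L) := by
    rw [Real.rpow_def_of_pos hL0]; ring_nf
  have eq : (X : ℝ) ^ (3 / 8 : ℝ) * Real.exp (L ^ (1 - δ / 2)) * L ^ (6 * A) =
      Real.exp (3 / 8 * L + L ^ (1 - δ / 2) + 6 * A * Real.log L) := by
    rw [Real.exp_add, Real.exp_add, ← e1, ← e5]
  rw [eq, eX, Real.exp_le_exp]
  linarith

/-- From `k + L^{a} + b log L ≤ L`: `exp k · exp(L^a) · L^b ≤ X`. [folklore] -/
theorem exp_form_gen {X : ℕ} {k a b : ℝ} (hL : 64 ≤ Real.log X)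
    (h : k + Real.log X ^ a + b * Real.log (Real.log X) ≤ Real.log X) :
    Real.exp k * Real.exp (Real.log X ^ a) * Real.log X ^ b ≤ X := by
  obtain ⟨hX3, hX0⟩ := X_large hL
  set L := Real.log X with hLdef
  have hL0 : 0 < L := by linarith
  have eX : (X : ℝ) = Real.exp L := (Real.exp_log hX0).symm
  have e5 : L ^ b = Real.exp (b * Real.log L) := by
    rw [Real.rpow_def_of_pos hL0]; ring_nf
  have eq : Real.exp k * Real.exp (L ^ a) * L ^ b = Real.exp (k + L ^ a + b * Real.log L) := by
    rw [Real.exp_add, Real.exp_add, ← e5]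
  rw [eq, eX, Real.exp_le_exp]
  exact h

set_option maxHeartbeats 1600000 in
-- explicit-constant bookkeeping for the count of bad intervals
/-- **(5.10) at a large `X`**: every set `B` of bad unit intervals below `T' = ⌊T⌋ + 1 ≤ 3X` has
`#B √T' ≤ Y/Q₂`: for `T' ≤ X^{1/4}` trivially (`#B ≤ T'`, `X^{3/8} Q₂ L^{6A} ≤ X`), otherwise by
`card_bad_le` (`#ℐ₁ ≤ 2VL`, `Q₁^{1/3} ≤ exp(L^{2/3}/3)`, `T' ≤ 3X`, and
`exp(16 (V log T'/v₀) log log T') ≤ T'^{64/(cA)}` as `v₀ ≥ VcA log L/2`, `log log T' ≤ 2 log L`).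
[cite: Lichtman2020, (5.10)] -/
theorem cardB_bound {q : ℕ} (χ : DirichletCharacter ℂ q) {c A : ℝ} {X Hx : ℕ} {Y T Q₂ : ℝ}
    (hL : 64 ≤ Real.log X) (hcA : 500 ≤ c * A) (hA : 1 ≤ A) (hc1 : 1 ≤ c)
    (hHx : (Hx : ℝ) ≤ Real.exp (Real.log X ^ (2 / 3 : ℝ)))
    (hPQ₁ : Real.log X ^ (c * A) ≤ (Hx : ℝ) / Real.log X ^ (4 * A))
    (hT2X : T ≤ 2 * X) (hYlo : (X : ℝ) / Real.log X ^ (6 * A) ≤ Y) (hQ₂1 : 1 ≤ Q₂)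
    (hF8 : (X : ℝ) ^ (3 / 8 : ℝ) * Q₂ * Real.log X ^ (6 * A) ≤ X)
    (hF12 : 2304 * Real.log X ^ (11 * A) * Real.log X * Real.exp (Real.log X ^ (2 / 3 : ℝ) / 3) *
        (3 * (X : ℝ)) ^ (5 / 6 + 64 / (c * A)) * Q₂ * Real.log X ^ (6 * A) ≤ X)
    (B : Finset ℕ) (hBsub : B ⊆ Finset.Ico ⌊Real.log X ^ (22 * A)⌋₊ (⌊T⌋₊ + 1))
    (hbad : ∀ n ∈ B, ∃ t ∈ Set.Icc (n : ℝ) (n + 1),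
      ∃ u ∈ Icc ⌊Real.log X ^ (11 * A) * Real.log (Real.log X ^ (c * A))⌋₊
        ⌊Real.log X ^ (11 * A) * Real.log ((Hx : ℝ) / Real.log X ^ (4 * A))⌋₊,
        Real.exp (-(1 / 6 * u / Real.log X ^ (11 * A))) <
          ‖blockPrimePoly (lamChi χ) (Real.log X ^ (c * A)) ((Hx : ℝ) / Real.log X ^ (4 * A))
            (Real.log X ^ (11 * A)) u t‖) :
    (#B : ℝ) * Real.sqrt ((⌊T⌋₊ : ℝ) + 1) ≤ Y / Q₂ := by
  obtain ⟨hX3, hX0⟩ := X_large hL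
  obtain ⟨hlog3, hlog2⟩ := log_three_le_two
  set L := Real.log X with hLdef
  set V := L ^ (11 * A) with hVdef
  set P₁ := L ^ (c * A) with hP₁def
  set Q₁ := (Hx : ℝ) / L ^ (4 * A) with hQ₁def
  set T' : ℝ := (⌊T⌋₊ : ℝ) + 1 with hT'def
  have hL1 : 1 ≤ L := by linarith
  have hL0 : 0 < L := by linarith
  have hX1 : (1 : ℝ) ≤ X := by linarith
  have hQ₂0 : 0 < Q₂ := by linarith
  have hV1 : 1 ≤ V := Real.one_le_rpow hL1 (by positivity)
  have hV0 : 0 < V := by linarith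
  have hP₁L : L ≤ P₁ := by
    calc L = L ^ (1 : ℝ) := (Real.rpow_one L).symm
      _ ≤ L ^ (c * A) := Real.rpow_le_rpow_of_exponent_le hL1 (by nlinarith)
  have hP₁0 : 0 < P₁ := by linarith
  have hQ₁1 : 1 ≤ Q₁ := le_trans (by linarith) hPQ₁
  have hQ₁0 : 0 < Q₁ := by linarith
  have h4A : 1 ≤ L ^ (4 * A) := Real.one_le_rpow hL1 (by positivity)
  have hQ₁H : Q₁ ≤ Hx := div_le_self (Nat.cast_nonneg _) h4A
  have hlogQ₁ : Real.log Q₁ ≤ L := by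
    have h1 : Q₁ ≤ Real.exp (L ^ (2 / 3 : ℝ)) := hQ₁H.trans hHx
    have h2 : Real.log Q₁ ≤ L ^ (2 / 3 : ℝ) := by
      rw [← Real.log_exp (L ^ (2 / 3 : ℝ))]; exact Real.log_le_log hQ₁0 h1
    have h3 : L ^ (2 / 3 : ℝ) ≤ L := by
      calc L ^ (2 / 3 : ℝ) ≤ L ^ (1 : ℝ) := Real.rpow_le_rpow_of_exponent_le hL1 (by norm_num)
        _ = L := Real.rpow_one L
    linarith
  -- `T'`
  have hT'1 : 1 ≤ T' := by simp [hT'def]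
  have hT'0 : 0 < T' := by linarith
  have hT'3X : T' ≤ 3 * X := by
    have h1 : (⌊T⌋₊ : ℝ) ≤ max T 0 := by
      rcases le_or_gt 0 T with h | h
      · rw [max_eq_left h]; exact Nat.floor_le h
      · rw [Nat.floor_of_nonpos h.le]; simp
    have h2 : max T 0 ≤ 2 * X := max_le hT2X (by positivity)
    simp only [hT'def]; linarith
  -- the target through `X/(L^{6A} Q₂) ≤ Y/Q₂`
  have h6A : 0 < L ^ (6 * A) := Real.rpow_pos_of_pos hL0 _
  have hgoal : ∀ Z : ℝ, Z * Q₂ * L ^ (6 * A) ≤ X → Z ≤ Y / Q₂ := by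
    intro Z hZ
    rw [le_div_iff₀ hQ₂0]
    have h1 : Z * Q₂ ≤ X / L ^ (6 * A) := by
      rw [le_div_iff₀ h6A]; exact hZ
    exact h1.trans hYlo
  -- two cases
  rcases le_or_gt T' ((X : ℝ) ^ (1 / 4 : ℝ)) with hsmall | hlarge
  · -- trivial count
    apply hgoal
    have hcard : (#B : ℝ) ≤ T' := by
      have h1 := Finset.card_le_card hBsub
      rw [Nat.card_Ico] at h1
      have h2 : #B ≤ ⌊T⌋₊ + 1 := h1.trans (Nat.sub_le _ _)
      simp only [hT'def]; exact_mod_cast h2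
    have hsq : Real.sqrt T' ≤ (X : ℝ) ^ (1 / 8 : ℝ) := by
      rw [Real.sqrt_eq_rpow]
      calc T' ^ (1 / 2 : ℝ) ≤ ((X : ℝ) ^ (1 / 4 : ℝ)) ^ (1 / 2 : ℝ) :=
            Real.rpow_le_rpow hT'0.le hsmall (by norm_num)
        _ = (X : ℝ) ^ (1 / 8 : ℝ) := by rw [← Real.rpow_mul hX0.le]; norm_num
    have h38 : (#B : ℝ) * Real.sqrt T' ≤ (X : ℝ) ^ (3 / 8 : ℝ) := by
      calc (#B : ℝ) * Real.sqrt T' ≤ (X : ℝ) ^ (1 / 4 : ℝ) * (X : ℝ) ^ (1 / 8 : ℝ) :=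
            mul_le_mul (hcard.trans hsmall) hsq (Real.sqrt_nonneg _) (Real.rpow_nonneg hX0.le _)
        _ = (X : ℝ) ^ (3 / 8 : ℝ) := by rw [← Real.rpow_add hX0]; norm_num
    calc (#B : ℝ) * Real.sqrt T' * Q₂ * L ^ (6 * A) ≤ (X : ℝ) ^ (3 / 8 : ℝ) * Q₂ * L ^ (6 * A) := by
          gcongr
      _ ≤ X := hF8
  · -- Lemma 8 count
    apply hgoal
    set v₀ := ⌊V * Real.log P₁⌋₊ with hv₀def
    have hlogP₁ : Real.log P₁ = c * A * Real.log L := by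
      rw [hP₁def, Real.log_rpow hL0]
    have hlogL : 4 ≤ Real.log L := by
      have h1 : Real.log 64 ≤ Real.log L := Real.log_le_log (by norm_num) hL
      have h2 : (4 : ℝ) ≤ Real.log 64 := by
        rw [Real.le_log_iff_exp_le (by norm_num)]
        have he := Real.exp_one_lt_d9
        have hsq : Real.exp 1 ^ 2 ≤ 7.39 := by nlinarith [Real.exp_pos 1]
        have h4 : Real.exp 4 = (Real.exp 1 ^ 2) ^ 2 := by
          rw [← pow_mul, ← Real.exp_nat_mul]; norm_num
        rw [h4]; nlinarith [hsq, pow_nonneg (Real.exp_pos 1).le 2]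
      linarith
    have hVlogP₁ : 2 ≤ V * Real.log P₁ := by
      rw [hlogP₁]
      have h1 : 2000 ≤ c * A * Real.log L := by nlinarith
      calc (2 : ℝ) ≤ 1 * 2000 := by norm_num
        _ ≤ V * (c * A * Real.log L) := mul_le_mul hV1 h1 (by norm_num) hV0.le
    have hv₀1 : 1 ≤ v₀ := by
      rw [hv₀def, Nat.one_le_floor_iff]; linarith
    have hv₀ge : V * (c * A * Real.log L) / 2 ≤ (v₀ : ℝ) := by
      have := Nat.lt_floor_add_one (V * Real.log P₁)
      rw [hlogP₁] at this hVlogP₁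
      rw [hv₀def, hlogP₁]; linarith
    have hv₀0 : (0 : ℝ) < v₀ := by exact_mod_cast hv₀1
    -- blocks of the first interval in the range of Lemma 8
    have hXquarter : Real.exp (L ^ (2 / 3 : ℝ)) ≤ (X : ℝ) ^ (1 / 4 : ℝ) := by
      rw [Real.rpow_def_of_pos hX0, ← hLdef, Real.exp_le_exp]
      -- `L^{2/3} ≤ L/4` as `4 ≤ L^{1/3}`
      have h13 : (4 : ℝ) ≤ L ^ (1 / 3 : ℝ) := by
        have : (64 : ℝ) ^ (1 / 3 : ℝ) ≤ L ^ (1 / 3 : ℝ) := Real.rpow_le_rpow (by norm_num) hL (by norm_num)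
        have e : (64 : ℝ) ^ (1 / 3 : ℝ) = 4 := by
          rw [show (64 : ℝ) = 4 ^ (3 : ℝ) by norm_num, ← Real.rpow_mul (by norm_num)]; norm_num
        linarith
      have e2 : L = L ^ (2 / 3 : ℝ) * L ^ (1 / 3 : ℝ) := by
        rw [← Real.rpow_add hL0]; norm_num
      have h0 : 0 ≤ L ^ (2 / 3 : ℝ) := Real.rpow_nonneg hL0.le _
      nlinarith
    have hTe : Real.exp (Real.exp 1) ≤ T' := by
      have h1 : Real.exp (Real.exp 1) ≤ Real.exp (L ^ (2 / 3 : ℝ)) := by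
        rw [Real.exp_le_exp]
        have h2 : Real.exp 1 ≤ 3 := by have := Real.exp_one_lt_d9; linarith
        have h3 : (3 : ℝ) ≤ L ^ (2 / 3 : ℝ) := by
          have : (64 : ℝ) ^ (2 / 3 : ℝ) ≤ L ^ (2 / 3 : ℝ) := Real.rpow_le_rpow (by norm_num) hL (by norm_num)
          have e : (64 : ℝ) ^ (2 / 3 : ℝ) = 16 := by
            rw [show (64 : ℝ) = 4 ^ (3 : ℝ) by norm_num, ← Real.rpow_mul (by norm_num)]; norm_num
          linarith
        linarith
      linarith
    have hblocks : ∀ u ∈ Icc v₀ ⌊V * Real.log Q₁⌋₊, 2 ≤ Real.exp (u / V) ∧ Real.exp (u / V) ≤ T' := by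
      intro u hu
      rw [Finset.mem_Icc] at hu
      constructor
      · -- `e^{u/V} ≥ e^{log P₁ - 1} ≥ P₁/3 ≥ 2`
        have h1 : Real.log P₁ - 1 ≤ (u : ℝ) / V := by
          rw [le_div_iff₀ hV0]
          have h2 : (v₀ : ℝ) ≤ u := by exact_mod_cast hu.1
          have h3 : V * Real.log P₁ - 1 ≤ (v₀ : ℝ) := by
            have := Nat.lt_floor_add_one (V * Real.log P₁); rw [hv₀def]; linarith
          nlinarith
        have h4 : Real.exp (Real.log P₁ - 1) ≤ Real.exp (u / V) := Real.exp_le_exp.mpr h1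
        have h5 : Real.exp (Real.log P₁ - 1) = P₁ / Real.exp 1 := by
          rw [Real.exp_sub, Real.exp_log hP₁0]
        have h6 : Real.exp 1 ≤ 3 := by have := Real.exp_one_lt_d9; linarith
        have h7 : 6 ≤ P₁ := by linarith
        have h8 : 2 ≤ P₁ / Real.exp 1 := by
          rw [le_div_iff₀ (Real.exp_pos 1)]; nlinarith
        linarith
      · -- `e^{u/V} ≤ Q₁ ≤ Hx ≤ exp(L^{2/3}) ≤ X^{1/4} < T'`
        have h1 : Real.exp (u / V) ≤ Q₁ := by
          have := exp_mul_div_le_rpow hV0 hQ₁1 zero_le_one hu.2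
          simpa using this
        calc Real.exp (u / V) ≤ Q₁ := h1
          _ ≤ Hx := hQ₁H
          _ ≤ Real.exp (L ^ (2 / 3 : ℝ)) := hHx
          _ ≤ (X : ℝ) ^ (1 / 4 : ℝ) := hXquarter
          _ ≤ T' := hlarge.le
    have hB' : ∀ n ∈ B, n ≤ ⌊T⌋₊ ∧ ∃ t ∈ Set.Icc (n : ℝ) (n + 1), ∃ u ∈ Icc v₀ ⌊V * Real.log Q₁⌋₊,
        Real.exp (-(1 / 6 * u / V)) < ‖blockPrimePoly (lamChi χ) P₁ Q₁ V u t‖ := by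
      intro n hn
      refine ⟨?_, hbad n hn⟩
      have := Finset.mem_Ico.mp (hBsub hn); omega
    have hV2 : (2 : ℝ) ≤ V := by
      calc (2 : ℝ) ≤ L := by linarith
        _ = L ^ (1 : ℝ) := (Real.rpow_one L).symm
        _ ≤ L ^ (11 * A) := Real.rpow_le_rpow_of_exponent_le hL1 (by nlinarith)
    have key := card_bad_le (norm_lamChi_le χ) hV2 (by norm_num : (0 : ℝ) < 1 / 6)
      hQ₁1 hv₀1 ⌊T⌋₊ hTe hblocks B hB'
    -- bound the factors
    have hI : (#(Icc v₀ ⌊V * Real.log Q₁⌋₊) : ℝ) ≤ 2 * V * L := by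
      rw [Nat.card_Icc]
      have h1 : ((⌊V * Real.log Q₁⌋₊ + 1 - v₀ : ℕ) : ℝ) ≤ ⌊V * Real.log Q₁⌋₊ + 1 := by
        exact_mod_cast Nat.sub_le _ _
      refine h1.trans ?_
      have h2 : (⌊V * Real.log Q₁⌋₊ : ℝ) ≤ V * Real.log Q₁ :=
        Nat.floor_le (mul_nonneg hV0.le (Real.log_nonneg hQ₁1))
      have h3 : V * Real.log Q₁ ≤ V * L := mul_le_mul_of_nonneg_left hlogQ₁ hV0.le
      have h4 : 1 ≤ V * L := by nlinarith
      linarith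
    have h2α : (2 * (1 / 6) : ℝ) = 1 / 3 := by norm_num
    rw [h2α] at key
    have hQ13 : Q₁ ^ (1 / 3 : ℝ) ≤ Real.exp (L ^ (2 / 3 : ℝ) / 3) := by
      calc Q₁ ^ (1 / 3 : ℝ) ≤ (Real.exp (L ^ (2 / 3 : ℝ))) ^ (1 / 3 : ℝ) :=
            Real.rpow_le_rpow hQ₁0.le (hQ₁H.trans hHx) (by norm_num)
        _ = Real.exp (L ^ (2 / 3 : ℝ) / 3) := by rw [← Real.exp_mul]; ring_nf
    have h3X0 : (0 : ℝ) < 3 * X := by positivity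
    have hT13 : T' ^ (1 / 3 : ℝ) ≤ (3 * (X : ℝ)) ^ (1 / 3 : ℝ) := Real.rpow_le_rpow hT'0.le hT'3X (by norm_num)
    -- the exponential factor
    have hlogT' : 1 ≤ Real.log T' := by
      rw [← Real.log_exp 1]
      refine Real.log_le_log (Real.exp_pos 1) ?_
      have : Real.exp 1 ≤ Real.exp (Real.exp 1) := Real.exp_le_exp.mpr (by have := Real.add_one_le_exp (1:ℝ); linarith)
      linarith
    have hlogT'0 : 0 ≤ Real.log T' := by linarith
    have hllT' : Real.log (Real.log T') ≤ 2 * Real.log L := by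
      have h1 : Real.log T' ≤ Real.log 3 + L := by
        rw [hLdef, ← Real.log_mul (by norm_num) hX0.ne']
        exact Real.log_le_log hT'0 hT'3X
      have h2 : Real.log 3 + L ≤ L ^ 2 := by nlinarith
      calc Real.log (Real.log T') ≤ Real.log (L ^ 2) := Real.log_le_log (by linarith) (h1.trans h2)
        _ = 2 * Real.log L := by rw [Real.log_pow]; push_cast; ring
    have hllT'0 : 0 ≤ Real.log (Real.log T') := Real.log_nonneg hlogT'
    have hE : Real.exp (16 * (V * Real.log T' / v₀) * Real.log (Real.log T')) ≤ (3 * (X : ℝ)) ^ (64 / (c * A)) := by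
      have hcA0 : 0 < c * A := by linarith
      have h1 : 16 * (V * Real.log T' / v₀) * Real.log (Real.log T') ≤ 64 / (c * A) * Real.log T' := by
        -- `16 V log log T'/v₀ ≤ 64/(cA)`
        have h2 : 16 * V * Real.log (Real.log T') / v₀ ≤ 64 / (c * A) := by
          rw [div_le_div_iff₀ hv₀0 hcA0]
          calc 16 * V * Real.log (Real.log T') * (c * A) ≤ 16 * V * (2 * Real.log L) * (c * A) := by
                gcongr
            _ = 64 * (V * (c * A * Real.log L) / 2) := by ring
            _ ≤ 64 * v₀ := by gcongr
        have e : 16 * (V * Real.log T' / v₀) * Real.log (Real.log T') =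
            (16 * V * Real.log (Real.log T') / v₀) * Real.log T' := by
          field_simp
        rw [e]
        exact mul_le_mul_of_nonneg_right h2 hlogT'0
      calc Real.exp (16 * (V * Real.log T' / v₀) * Real.log (Real.log T'))
          ≤ Real.exp (64 / (c * A) * Real.log T') := Real.exp_le_exp.mpr h1
        _ = T' ^ (64 / (c * A)) := by rw [Real.rpow_def_of_pos hT'0]; ring_nf
        _ ≤ (3 * (X : ℝ)) ^ (64 / (c * A)) := Real.rpow_le_rpow hT'0.le hT'3X (by positivity)
    have hsqrt : Real.sqrt T' ≤ (3 * (X : ℝ)) ^ (1 / 2 : ℝ) := by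
      rw [Real.sqrt_eq_rpow]; exact Real.rpow_le_rpow hT'0.le hT'3X (by norm_num)
    -- assemble
    have hE0 : 0 ≤ Real.exp (16 * (V * Real.log T' / v₀) * Real.log (Real.log T')) := (Real.exp_pos _).le
    have hprod : (#B : ℝ) * Real.sqrt T' ≤
        2 * V * L * (1152 * Real.exp (L ^ (2 / 3 : ℝ) / 3) * (3 * (X : ℝ)) ^ (1 / 3 : ℝ) *
          (3 * (X : ℝ)) ^ (64 / (c * A))) * (3 * (X : ℝ)) ^ (1 / 2 : ℝ) := by
      have h1 : (#B : ℝ) ≤ 2 * V * L * (1152 * Real.exp (L ^ (2 / 3 : ℝ) / 3) * (3 * (X : ℝ)) ^ (1 / 3 : ℝ) *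
          (3 * (X : ℝ)) ^ (64 / (c * A))) := by
        refine key.trans ?_
        have hfac : 1152 * Q₁ ^ (1 / 3 : ℝ) * T' ^ (1 / 3 : ℝ) *
            Real.exp (16 * (V * Real.log T' / v₀) * Real.log (Real.log T')) ≤
            1152 * Real.exp (L ^ (2 / 3 : ℝ) / 3) * (3 * (X : ℝ)) ^ (1 / 3 : ℝ) * (3 * (X : ℝ)) ^ (64 / (c * A)) := by
          gcongr
        have hfac0 : 0 ≤ 1152 * Q₁ ^ (1 / 3 : ℝ) * T' ^ (1 / 3 : ℝ) *
            Real.exp (16 * (V * Real.log T' / v₀) * Real.log (Real.log T')) := by positivity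
        calc (#(Icc v₀ ⌊V * Real.log Q₁⌋₊) : ℝ) * (1152 * Q₁ ^ (1 / 3 : ℝ) * (((⌊T⌋₊ : ℕ) : ℝ) + 1) ^ (1 / 3 : ℝ) *
              Real.exp (16 * (V * Real.log (((⌊T⌋₊ : ℕ) : ℝ) + 1) / v₀) * Real.log (Real.log (((⌊T⌋₊ : ℕ) : ℝ) + 1))))
            ≤ (2 * V * L) * (1152 * Q₁ ^ (1 / 3 : ℝ) * T' ^ (1 / 3 : ℝ) *
              Real.exp (16 * (V * Real.log T' / v₀) * Real.log (Real.log T'))) :=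
              mul_le_mul_of_nonneg_right hI hfac0
          _ ≤ (2 * V * L) * (1152 * Real.exp (L ^ (2 / 3 : ℝ) / 3) * (3 * (X : ℝ)) ^ (1 / 3 : ℝ) *
              (3 * (X : ℝ)) ^ (64 / (c * A))) := mul_le_mul_of_nonneg_left hfac (by positivity)
      exact mul_le_mul h1 hsqrt (Real.sqrt_nonneg _) ((Nat.cast_nonneg _).trans h1)
    have hcomb : 2 * V * L * (1152 * Real.exp (L ^ (2 / 3 : ℝ) / 3) * (3 * (X : ℝ)) ^ (1 / 3 : ℝ) *
          (3 * (X : ℝ)) ^ (64 / (c * A))) * (3 * (X : ℝ)) ^ (1 / 2 : ℝ) =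
        2304 * V * L * Real.exp (L ^ (2 / 3 : ℝ) / 3) * (3 * (X : ℝ)) ^ (5 / 6 + 64 / (c * A)) := by
      have e : (3 * (X : ℝ)) ^ (5 / 6 + 64 / (c * A)) =
          (3 * (X : ℝ)) ^ (1 / 3 : ℝ) * (3 * (X : ℝ)) ^ (64 / (c * A)) * (3 * (X : ℝ)) ^ (1 / 2 : ℝ) := by
        rw [← Real.rpow_add h3X0, ← Real.rpow_add h3X0]; congr 1; ring
      rw [e]; ring
    rw [hcomb] at hprod
    calc (#B : ℝ) * Real.sqrt T' * Q₂ * L ^ (6 * A)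
        ≤ 2304 * V * L * Real.exp (L ^ (2 / 3 : ℝ) / 3) * (3 * (X : ℝ)) ^ (5 / 6 + 64 / (c * A)) * Q₂ * L ^ (6 * A) := by
          gcongr
      _ ≤ X := hF12

end Literature.NumberTheory.Sieve.Lichtman2020

namespace Literature.NumberTheory.Sieve.Lichtman2020

/-- The final real arithmetic: `C (a (e K) + E₁) + C (B₁ + E₂) ≤ C (2000 + 720 C₉ D²)(R+1) s`. [folklore] -/
theorem final_numerics {C C₉ D s R a e K E₁ B₁ E₂ : ℝ} (hC : 0 ≤ C) (hC₉ : 0 ≤ C₉)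
    (hs : 0 ≤ s) (hR : 0 ≤ R) (hK : 0 ≤ K)
    (h1 : a * e ≤ 24 * s) (h5 : K ≤ 82 * (R + 1)) (h2 : E₁ ≤ 4 * (R + 1) * s)
    (h3 : B₁ ≤ 720 * C₉ * D ^ 2 * s) (h4 : E₂ ≤ 4 * (R + 1) * s) :
    C * (a * (e * K) + E₁) + C * (B₁ + E₂) ≤ C * (2000 + 720 * C₉ * D ^ 2) * (R + 1) * s := by
  have hK' : a * (e * K) ≤ 24 * s * (82 * (R + 1)) := by
    rw [← mul_assoc]; exact mul_le_mul h1 h5 hK (by positivity)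
  have hB' : B₁ ≤ 720 * C₉ * D ^ 2 * ((R + 1) * s) := by
    refine h3.trans ?_
    have : s ≤ (R + 1) * s := by nlinarith
    exact mul_le_mul_of_nonneg_left this (by positivity)
  have hin : (a * (e * K) + E₁) + (B₁ + E₂) ≤ (2000 + 720 * C₉ * D ^ 2) * (R + 1) * s := by nlinarith
  calc C * (a * (e * K) + E₁) + C * (B₁ + E₂) = C * ((a * (e * K) + E₁) + (B₁ + E₂)) := by ring
    _ ≤ C * ((2000 + 720 * C₉ * D ^ 2) * (R + 1) * s) := mul_le_mul_of_nonneg_left hin hC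
    _ = _ := by ring

/-- The `E₁` factor: `V log(Q₁/P₁) e^{1/(3V)} P₁^{-1/3} (1 + 3V) ≤ 24 L^{-11A}` for
`V = L^{11A}`, `P₁ = L^{cA}`, `c ≥ 100`, `A > 5`, `log Q₁ ≤ L`. [cite: Lichtman2020, §5.1, bound for E₁] -/
theorem E1_factor_numerics {V L P₁ Q₁ c A : ℝ} (hL1 : 1 ≤ L) (hA : 5 < A) (hc : 100 ≤ c)
    (hV : V = L ^ (11 * A)) (hP₁ : P₁ = L ^ (c * A)) (hPQ : P₁ ≤ Q₁) (hlogQ₁ : Real.log Q₁ ≤ L) :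
    (V * Real.log (Q₁ / P₁)) *
        (Real.exp (2 * (1 / 6 : ℝ) / V) * P₁ ^ (-(2 * (1 / 6 : ℝ))) * (1 + V / (2 * (1 / 6 : ℝ)))) ≤
      24 * L ^ (-(11 * A)) := by
  have hL0 : 0 < L := by linarith
  have hV1 : 1 ≤ V := by rw [hV]; exact Real.one_le_rpow hL1 (by linarith)
  have hV0 : 0 < V := by linarith
  have hP₁1 : 1 ≤ P₁ := by rw [hP₁]; exact Real.one_le_rpow hL1 (by nlinarith)
  have hP₁0 : 0 < P₁ := by linarith
  have hQ₁0 : 0 < Q₁ := by linarith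
  have hlog : Real.log (Q₁ / P₁) ≤ L := by
    rw [Real.log_div hQ₁0.ne' hP₁0.ne']
    linarith [Real.log_nonneg hP₁1]
  have hlog0 : 0 ≤ Real.log (Q₁ / P₁) := Real.log_nonneg (by rw [le_div_iff₀ hP₁0]; linarith)
  have ha : V * Real.log (Q₁ / P₁) ≤ 2 * V * L := by
    have : V * Real.log (Q₁ / P₁) ≤ V * L := mul_le_mul_of_nonneg_left hlog hV0.le
    nlinarith
  have hb : Real.exp (2 * (1 / 6 : ℝ) / V) ≤ 3 := by
    have h2 : 2 * (1 / 6 : ℝ) / V ≤ 1 := by rw [div_le_one hV0]; linarith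
    have := Real.exp_one_lt_d9
    linarith [Real.exp_le_exp.mpr h2]
  have hcexp : P₁ ^ (-(2 * (1 / 6 : ℝ))) = L ^ (-(c * A / 3)) := by
    rw [hP₁, ← Real.rpow_mul hL0.le]; congr 1; ring
  have hd : 1 + V / (2 * (1 / 6 : ℝ)) ≤ 4 * V := by
    have : V / (2 * (1 / 6 : ℝ)) = 3 * V := by ring
    linarith
  have hL3 : 0 ≤ L ^ (-(c * A / 3)) := Real.rpow_nonneg hL0.le _
  have hVVL : V * V * L = L ^ (22 * A + 1) := by
    rw [hV, ← Real.rpow_add hL0, ← Real.rpow_add_one hL0.ne']; congr 1; ring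
  calc (V * Real.log (Q₁ / P₁)) *
        (Real.exp (2 * (1 / 6 : ℝ) / V) * P₁ ^ (-(2 * (1 / 6 : ℝ))) * (1 + V / (2 * (1 / 6 : ℝ))))
      ≤ (2 * V * L) * (3 * L ^ (-(c * A / 3)) * (4 * V)) := by
        rw [hcexp]
        refine mul_le_mul ha ?_ (by positivity) (by positivity)
        exact mul_le_mul (mul_le_mul_of_nonneg_right hb hL3) hd (by positivity) (by positivity)
    _ = 24 * (V * V * L) * L ^ (-(c * A / 3)) := by ring
    _ = 24 * L ^ (22 * A + 1 + (-(c * A / 3))) := by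
        rw [hVVL, mul_assoc, ← Real.rpow_add hL0]
    _ ≤ 24 * L ^ (-(11 * A)) := by
        refine mul_le_mul_of_nonneg_left (Real.rpow_le_rpow_of_exponent_le hL1 ?_) (by norm_num)
        nlinarith

/-- The `E₂` factor: `V log(Q₂/P₂) #ℐ₂ · 10 C₉ U² log(2T') ≤ 720 C₉ D² L^{-11A}` for
`V = L^{11A}`, `P₂ = exp(L^{2/3+δ/2}) ≤ Q₂ = exp(L^{1-δ/2})`, `U = 3D L^{1-22A}`, `log(2T') ≤ 2L`, `A > 5`.
[cite: Lichtman2020, §5.1, bound for E₂] -/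
theorem E2_factor_numerics {V L P₂ Q₂ δ A D C₉ T' : ℝ} (hL1 : 1 ≤ L) (hA : 5 < A) (hδ : 0 < δ)
    (hC₉ : 0 ≤ C₉) (hV : V = L ^ (11 * A))
    (hP₂ : P₂ = Real.exp (L ^ (2 / 3 + δ / 2))) (hQ₂ : Q₂ = Real.exp (L ^ (1 - δ / 2)))
    (hPQ₂ : P₂ ≤ Q₂) (hT'1 : 1 ≤ T') (hlog2T' : Real.log (2 * T') ≤ 2 * L) :
    (V * Real.log (Q₂ / P₂)) * ((#(Icc ⌊V * Real.log P₂⌋₊ ⌊V * Real.log Q₂⌋₊) : ℝ) *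
        (10 * C₉ * (3 * D * L ^ (1 - 22 * A)) ^ 2 * Real.log (2 * T'))) ≤
      720 * C₉ * D ^ 2 * L ^ (-(11 * A)) := by
  have hL0 : 0 < L := by linarith
  have hV1 : 1 ≤ V := by rw [hV]; exact Real.one_le_rpow hL1 (by linarith)
  have hV0 : 0 < V := by linarith
  have hP₂0 : 0 < P₂ := by rw [hP₂]; exact Real.exp_pos _
  have hQ₂0 : 0 < Q₂ := by rw [hQ₂]; exact Real.exp_pos _
  have hQ₂1 : 1 ≤ Q₂ := by rw [hQ₂]; exact Real.one_le_exp (Real.rpow_nonneg hL0.le _)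
  have hlogQ₂ : Real.log Q₂ = L ^ (1 - δ / 2) := by rw [hQ₂, Real.log_exp]
  have hlogP₂ : Real.log P₂ = L ^ (2 / 3 + δ / 2) := by rw [hP₂, Real.log_exp]
  have hL1δ : L ^ (1 - δ / 2) ≤ L := by
    calc L ^ (1 - δ / 2) ≤ L ^ (1 : ℝ) := Real.rpow_le_rpow_of_exponent_le hL1 (by linarith)
      _ = L := Real.rpow_one L
  have ha : V * Real.log (Q₂ / P₂) ≤ 2 * V * L := by
    rw [Real.log_div hQ₂0.ne' hP₂0.ne', hlogQ₂, hlogP₂]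
    have : 0 ≤ L ^ (2 / 3 + δ / 2) := Real.rpow_nonneg hL0.le _
    have : V * (L ^ (1 - δ / 2) - L ^ (2 / 3 + δ / 2)) ≤ V * L := by
      apply mul_le_mul_of_nonneg_left _ hV0.le; linarith
    nlinarith
  have hb : (#(Icc ⌊V * Real.log P₂⌋₊ ⌊V * Real.log Q₂⌋₊) : ℝ) ≤ 2 * V * L := by
    rw [Nat.card_Icc]
    have h1' : ((⌊V * Real.log Q₂⌋₊ + 1 - ⌊V * Real.log P₂⌋₊ : ℕ) : ℝ) ≤ ⌊V * Real.log Q₂⌋₊ + 1 := by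
      exact_mod_cast Nat.sub_le _ _
    refine h1'.trans ?_
    have h2' : (⌊V * Real.log Q₂⌋₊ : ℝ) ≤ V * Real.log Q₂ :=
      Nat.floor_le (mul_nonneg hV0.le (Real.log_nonneg hQ₂1))
    have h3' : V * Real.log Q₂ ≤ V * L := by
      rw [hlogQ₂]; exact mul_le_mul_of_nonneg_left hL1δ hV0.le
    have h4' : 1 ≤ V * L := by nlinarith
    linarith
  have hlog0 : 0 ≤ Real.log (2 * T') := Real.log_nonneg (by linarith)
  have hU2 : (3 * D * L ^ (1 - 22 * A)) ^ 2 = 9 * D ^ 2 * L ^ (2 - 44 * A) := by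
    have : (L ^ (1 - 22 * A)) ^ 2 = L ^ (2 - 44 * A) := by
      rw [← Real.rpow_natCast _ 2, ← Real.rpow_mul hL0.le]; congr 1; push_cast; ring
    rw [mul_pow, mul_pow, this]; ring
  have hLpow0 : 0 ≤ L ^ (2 - 44 * A) := Real.rpow_nonneg hL0.le _
  have hlogd0 : 0 ≤ Real.log (Q₂ / P₂) := Real.log_nonneg (by rw [le_div_iff₀ hP₂0]; linarith)
  have hVVL : V * V * L = L ^ (22 * A + 1) := by
    rw [hV, ← Real.rpow_add hL0, ← Real.rpow_add_one hL0.ne']; congr 1; ring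
  have hLL : L * L = L ^ (2 : ℝ) := by rw [Real.rpow_two, sq]
  calc (V * Real.log (Q₂ / P₂)) * ((#(Icc ⌊V * Real.log P₂⌋₊ ⌊V * Real.log Q₂⌋₊) : ℝ) *
        (10 * C₉ * (3 * D * L ^ (1 - 22 * A)) ^ 2 * Real.log (2 * T')))
      ≤ (2 * V * L) * ((2 * V * L) * (10 * C₉ * (9 * D ^ 2 * L ^ (2 - 44 * A)) * (2 * L))) := by
        rw [hU2]
        refine mul_le_mul ha ?_ (by positivity) (by positivity)
        refine mul_le_mul hb ?_ (by positivity) (by positivity)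
        exact mul_le_mul_of_nonneg_left hlog2T' (by positivity)
    _ = 720 * C₉ * D ^ 2 * ((V * V * L) * (L * L) * L ^ (2 - 44 * A)) := by ring
    _ = 720 * C₉ * D ^ 2 * L ^ (22 * A + 1 + 2 + (2 - 44 * A)) := by
        rw [hVVL, hLL, ← Real.rpow_add hL0, ← Real.rpow_add hL0]
    _ ≤ 720 * C₉ * D ^ 2 * L ^ (-(11 * A)) := by
        refine mul_le_mul_of_nonneg_left (Real.rpow_le_rpow_of_exponent_le hL1 ?_) (by positivity)
        linarith

/-- The error terms: `(T'+Y)/Y (1/V + 1/P) ≤ 4 (R+1)/V` when `(T'+Y)/Y ≤ R + 2`, `V ≤ P`. [folklore] -/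
theorem err_numerics {V P T' Y R : ℝ} (hV0 : 0 < V) (hVP : V ≤ P) (hR : 0 ≤ R) (hY : 0 < Y)
    (hT' : 0 ≤ T') (hTY : (T' + Y) / Y ≤ R + 2) :
    (T' + Y) / Y * (1 / V + 1 / P) ≤ 4 * (R + 1) * (1 / V) := by
  have hP0 : 0 < P := by linarith
  have h2' : 1 / V + 1 / P ≤ 2 * (1 / V) := by
    have : 1 / P ≤ 1 / V := one_div_le_one_div_of_le hV0 hVP
    linarith
  have hTY0 : 0 ≤ (T' + Y) / Y := by positivity
  have hs0 : 0 < 1 / V := by positivity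
  calc (T' + Y) / Y * (1 / V + 1 / P) ≤ (R + 2) * (2 * (1 / V)) :=
        mul_le_mul hTY h2' (by positivity) (by positivity)
    _ ≤ 4 * (R + 1) * (1 / V) := by nlinarith

set_option maxHeartbeats 3200000 in
-- the asymptotic wrapper of Proposition 5.1: many eventual side conditions, one long proof
/-- **Lichtman 2020, Proposition 5.1 along `S_c` (`c ≥ 100`), strong form** — PROVED from the named
fact Lemma 4.5 (`Lichtman2020_primeCharacterSum`, the Vinogradov–Korobov input), all other inputs being
proved in the tree (Lemma 4.7 = MR Lemma 12: `MatomakiRadziwill2016_lemma12_decomp_holds`; Lemma 4.3 =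
MR Lemma 9: `MatomakiRadziwill2016_lemma9_holds`; Lemma 4.1: `dirichletPolynomial_meanSquare_le`;
Lemma 4.4: MR Lemma 8 with explicit exponent, `card_largeValues_primePoly_le`).  Strong form: `Y ∈ [X/(log X)^{6A}, 2X]`, `T ∈ [0, 2X]` (the
accepted fact `Lichtman2020_dirichletMeanValueWith` has `Y ≤ X`; the deduction of Proposition 3.4
also uses the scale `2Y ≤ 2X`).  Parameters: `B = 11A`, `V = (log X)^B`, `T₀ = (log X)^{2B}`,
`α = 1/6`, `K = 22A`; the saving `(log X)^{-B}` in `E₁` needs `cA/3 ≥ 33A + 1`, i.e. `c ≥ 100`.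
[cite: Lichtman2020, Proposition 5.1] -/
theorem dirichletMeanValue_strong (h45 : Lichtman2020_primeCharacterSum) :
    ∀ c : ℝ, 100 ≤ c → ∀ A : ℝ, 5 < A → ∀ δ : ℝ, 0 < δ → ∀ H : ℕ → ℕ,
    Tendsto (fun X : ℕ => Real.log (H X) / Real.log (Real.log X)) atTop atTop →
    (∀ᶠ X : ℕ in atTop, (H X : ℝ) ≤ Real.exp (Real.log X ^ (2 / 3 : ℝ))) →
    ∃ C : ℝ, ∀ᶠ X : ℕ in atTop, ∀ q : ℕ, 1 ≤ q → (q : ℝ) ≤ Real.log X ^ A →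
      ∀ χ : DirichletCharacter ℂ q, ∀ Y : ℝ, (X : ℝ) / Real.log X ^ (6 * A) ≤ Y → Y ≤ 2 * X →
        ∀ T : ℝ, 0 ≤ T → T ≤ 2 * X →
          ∫ t in (Real.log X ^ (22 * A))..T,
              ‖∑ n ∈ (Icc ⌈Y⌉₊ ⌊2 * Y⌋₊).filter (lichtmanTypicalWith c X A δ (H X)),
                  ((ArithmeticFunction.liouville n : ℤ) : ℂ) * χ (n : ZMod q) *
                    (n : ℂ) ^ (-(1 + (t : ℂ) * I))‖ ^ 2
            ≤ C * (((H X : ℝ) / Real.log X ^ (4 * A)) * T / Y + 1) / Real.log X ^ (11 * A) := by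
  intro c hc A hA δ hδ H hH hHcap
  obtain ⟨C₁₂, h12'⟩ := lemma12With_of_decomp MatomakiRadziwill2016_lemma12_decomp_holds
  obtain ⟨C₉, h9'⟩ := lemma9With_of Literature.NumberTheory.LFunctions.MatomakiRadziwill2016_lemma9_holds
  have hA0 : 0 < A := by linarith
  have hA1 : 1 ≤ A := by linarith
  have hc1 : 1 ≤ c := by linarith
  obtain ⟨C₄₅, h45'⟩ := h45 A (22 * A) (2 / 3 + δ / 4) hA0 (by positivity) (by linarith)
  set D := max C₄₅ 0 with hD
  have hD0 : 0 ≤ D := le_max_right _ _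
  set Cf : ℝ := max C₁₂ 0 * (2000 + 720 * max C₉ 0 * D ^ 2) with hCf
  refine ⟨Cf, ?_⟩
  have hcA : 500 ≤ c * A := by nlinarith
  have hcA0 : 0 < c * A := by linarith
  set κ : ℝ := 5 / 6 + 64 / (c * A) with hκdef
  have hκ0 : 0 ≤ κ := by positivity
  have hκ1 : 0 < 1 - κ := by
    have : 64 / (c * A) ≤ 64 / 500 := div_le_div_of_nonneg_left (by norm_num) (by norm_num) hcA
    rw [hκdef]; linarith
  filter_upwards [tendsto_log_natCast.eventually_ge_atTop (64 : ℝ), hHcap,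
    eventually_rpow_log_le_H hH ((c + 4) * A + 1),
    eventually_small_terms 0 (6 * A) (show (2 / 3 : ℝ) < 1 by norm_num) (show (2 / 3 : ℝ) < 1 by norm_num) one_pos,
    eventually_small_terms (Real.log 2) (6 * A) (show 1 - δ / 2 < 1 by linarith)
      (show 1 - δ / 2 < 1 by linarith) one_pos,
    eventually_small_terms 0 (6 * A) (show 1 - δ / 2 < 1 by linarith) (show (2 / 3 : ℝ) < 1 by norm_num)
      (show (0 : ℝ) < 5 / 8 by norm_num),
    eventually_small_terms (Real.log 2304 + κ * Real.log 3) (17 * A + 1) (show (2 / 3 : ℝ) < 1 by norm_num)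
      (show 1 - δ / 2 < 1 by linarith) hκ1,
    (tendsto_natCast_atTop_atTop (R := ℝ)).eventually
      (eventually_loglog_le (2 / 3 + δ / 2) (1 / (11 * A)) (by positivity) (by positivity)),
    ((tendsto_rpow_atTop (by positivity : (0 : ℝ) < δ / 4)).comp tendsto_log_natCast).eventually_ge_atTop
      ((2 : ℝ) ^ (2 / 3 + δ / 4))]
    with X hL64 hHx hHlow hF4 hF5 hF8 hF12 hF13 hF6
  intro q hq hqA χ Y hYlo hYhi T hT0 hT2X
  obtain ⟨hX3, hX0⟩ := X_large hL64
  set L := Real.log X with hLdef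
  have hL1 : 1 ≤ L := by linarith
  have hL1' : 1 < L := by linarith
  have hL0 : 0 < L := by linarith
  set Hx := H X with hHxdef
  set V := L ^ (11 * A) with hVdef
  set T₀ := L ^ (22 * A) with hT₀def
  set P₁ := L ^ (c * A) with hP₁def
  set Q₁ := (Hx : ℝ) / L ^ (4 * A) with hQ₁def
  set P₂ := Real.exp (L ^ (2 / 3 + δ / 2)) with hP₂def
  set Q₂ := Real.exp (L ^ (1 - δ / 2)) with hQ₂def
  -- basic positivity
  have hV1 : 1 ≤ V := Real.one_le_rpow hL1 (by positivity)
  have hV0 : 0 < V := by linarith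
  have hV2 : 2 ≤ V := by
    calc (2 : ℝ) ≤ L := by linarith
      _ = L ^ (1 : ℝ) := (Real.rpow_one L).symm
      _ ≤ L ^ (11 * A) := Real.rpow_le_rpow_of_exponent_le hL1 (by nlinarith)
  have hT₀0 : 0 ≤ T₀ := Real.rpow_nonneg hL0.le _
  have hP₁1 : 1 ≤ P₁ := Real.one_le_rpow hL1 (by positivity)
  have hP₁0 : 0 < P₁ := by linarith
  have h4A1 : 1 ≤ L ^ (4 * A) := Real.one_le_rpow hL1 (by positivity)
  have h4A0 : 0 < L ^ (4 * A) := by linarith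
  have h6A1 : 1 ≤ L ^ (6 * A) := Real.one_le_rpow hL1 (by positivity)
  have h6A0 : 0 < L ^ (6 * A) := by linarith
  have hP₂1 : 1 ≤ P₂ := Real.one_le_exp (Real.rpow_nonneg hL0.le _)
  have hQ₂1 : 1 ≤ Q₂ := Real.one_le_exp (Real.rpow_nonneg hL0.le _)
  have hQ₂0 : 0 < Q₂ := by linarith
  -- `P₁ L ≤ Q₁` from `L^{(c+4)A+1} ≤ Hx`
  have hsplit : L ^ ((c + 4) * A + 1) = P₁ * L ^ (4 * A) * L := by
    rw [hP₁def, ← Real.rpow_add hL0, Real.rpow_add_one hL0.ne']; congr 1; ring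
  have hPQ₁L : P₁ * L ≤ Q₁ := by
    rw [hQ₁def, le_div_iff₀ h4A0]
    calc P₁ * L * L ^ (4 * A) = L ^ ((c + 4) * A + 1) := by rw [hsplit]; ring
      _ ≤ Hx := hHlow
  have hPQ₁ : P₁ ≤ Q₁ := le_trans (le_mul_of_one_le_right hP₁0.le hL1) hPQ₁L
  have hQ₁1 : 1 ≤ Q₁ := hP₁1.trans hPQ₁
  have hQ₁0 : 0 < Q₁ := by linarith
  have hQ₁H : Q₁ ≤ Hx := div_le_self (Nat.cast_nonneg _) h4A1
  -- `Hx ≤ X/L^{6A} ≤ Y`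
  have hF4' : Real.exp (L ^ (2 / 3 : ℝ)) * L ^ (6 * A) ≤ X := by
    have h := exp_form_gen hL64 (k := 0) (a := 2 / 3) (b := 6 * A) (by
      have : 0 ≤ Real.log (X : ℝ) ^ (2 / 3 : ℝ) := Real.rpow_nonneg hL0.le _
      linarith)
    simpa using h
  have hHxY : (Hx : ℝ) ≤ X / L ^ (6 * A) := by
    rw [le_div_iff₀ h6A0]
    calc (Hx : ℝ) * L ^ (6 * A) ≤ Real.exp (L ^ (2 / 3 : ℝ)) * L ^ (6 * A) := by gcongr
      _ ≤ X := hF4'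
  have hHxX : (Hx : ℝ) ≤ X := hHxY.trans (div_le_self hX0.le h6A1)
  have hQ₁Y : Q₁ ≤ Y := hQ₁H.trans (hHxY.trans hYlo)
  have hY1 : 1 ≤ Y := hQ₁1.trans hQ₁Y
  have hY0 : 0 < Y := by linarith
  have hlogQ₁ : Real.log Q₁ ≤ L := by
    calc Real.log Q₁ ≤ Real.log X := Real.log_le_log hQ₁0 (hQ₁H.trans hHxX)
      _ = L := rfl
  -- `2 Q₂ ≤ X/L^{6A} ≤ Y`
  have hF5' : 2 * Q₂ * L ^ (6 * A) ≤ X := by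
    have h := exp_form_gen hL64 (k := Real.log 2) (a := 1 - δ / 2) (b := 6 * A) (by
      have : 0 ≤ Real.log (X : ℝ) ^ (1 - δ / 2) := Real.rpow_nonneg hL0.le _
      linarith)
    rwa [Real.exp_log (by norm_num : (0 : ℝ) < 2)] at h
  have hQ₂Y : 2 * Q₂ ≤ Y := by
    have : 2 * Q₂ ≤ X / L ^ (6 * A) := by rw [le_div_iff₀ h6A0]; exact hF5'
    exact this.trans hYlo
  have hQ₂X : Q₂ ≤ X := by linarith
  -- `Q₁ < P₂`, `V ≤ P₂`, `exp((2L)^θ) ≤ P₂`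
  have hQP : Q₁ < P₂ := by
    refine lt_of_le_of_lt (hQ₁H.trans hHx) ?_
    rw [hP₂def, Real.exp_lt_exp]
    exact Real.rpow_lt_rpow_of_exponent_lt hL1' (by linarith)
  have hVP₂ : V ≤ P₂ := by
    have h1 : 11 * A * Real.log L ≤ L ^ (2 / 3 + δ / 2) := by
      have h2 : Real.log L ≤ 1 / (11 * A) * L ^ (2 / 3 + δ / 2) := hF13
      have h3 := mul_le_mul_of_nonneg_left h2 (by positivity : (0 : ℝ) ≤ 11 * A)
      refine h3.trans (le_of_eq ?_)
      field_simp
    calc V = Real.exp (11 * A * Real.log L) := by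
          rw [hVdef, Real.rpow_def_of_pos hL0]; ring_nf
      _ ≤ P₂ := Real.exp_le_exp.mpr h1
  have hP₂' : Real.exp ((2 * Real.log X) ^ (2 / 3 + δ / 4)) ≤ P₂ := by
    rw [hP₂def, Real.exp_le_exp, ← hLdef, Real.mul_rpow (by norm_num) hL0.le]
    have e : L ^ (2 / 3 + δ / 2) = L ^ (δ / 4) * L ^ (2 / 3 + δ / 4) := by
      rw [← Real.rpow_add hL0]; congr 1; ring
    rw [e]
    exact mul_le_mul_of_nonneg_right hF6 (Real.rpow_nonneg hL0.le _)
  -- the exponential forms of F8 and F12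
  have hF8' : (X : ℝ) ^ (3 / 8 : ℝ) * Q₂ * L ^ (6 * A) ≤ X := by
    refine exp_form_F8 hL64 ?_
    have : 0 ≤ Real.log (X : ℝ) ^ (2 / 3 : ℝ) := Real.rpow_nonneg hL0.le _
    linarith
  have hF12' := exp_form_F12 hL64 hF12
  -- degenerate case `P₂ > Q₂`: `S = ∅`
  have hRHS0 : 0 ≤ Cf * (((Hx : ℝ) / L ^ (4 * A)) * T / Y + 1) / L ^ (11 * A) := by
    have : 0 ≤ max C₁₂ 0 := le_max_right _ _
    have : 0 ≤ max C₉ 0 := le_max_right _ _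
    positivity
  rcases lt_or_ge Q₂ P₂ with hPQ₂ | hPQ₂
  · have hempty : (Icc ⌈Y⌉₊ ⌊2 * Y⌋₊).filter (lichtmanTypicalWith c X A δ Hx) = ∅ := by
      rw [Finset.filter_eq_empty_iff]
      intro n _ hS
      obtain ⟨-, p, -, h1, h2⟩ := hS
      exact absurd (h1.trans h2) (not_le.mpr hPQ₂)
    rw [hempty]
    simp only [Finset.sum_empty, norm_zero]
    rw [zero_pow two_ne_zero, intervalIntegral.integral_zero]
    exact hRHS0
  -- degenerate case `T < T₀`
  rcases lt_or_ge T T₀ with hTlt | hTge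
  · refine le_trans ?_ hRHS0
    rw [intervalIntegral.integral_symm]
    refine neg_nonpos.mpr (intervalIntegral.integral_nonneg hTlt.le fun t _ => by positivity)
  -- the hypotheses of `prop51_fixed`
  have hX'2 : (2 : ℝ) ≤ (X : ℝ) ^ 2 := by nlinarith
  have h45X := h45' ((X : ℝ) ^ 2) hX'2
  have hUQ : ∀ v ∈ Icc ⌊V * Real.log P₂⌋₊ ⌊V * Real.log Q₂⌋₊, ∀ n ∈ Finset.Ico ⌊T₀⌋₊ (⌊T⌋₊ + 1),
      ∀ t ∈ Set.Icc (n : ℝ) (n + 1), ‖blockPrimePoly (lamChi χ) P₂ Q₂ V v t‖ ≤ 3 * D * L ^ (1 - 22 * A) :=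
    fun v _ n hn t ht => UQ_bound h45X hL64 hA0 hq hqA χ hP₂' hQ₂X hT2X v hn ht
  have hN1 : ∀ v ∈ Icc ⌊V * Real.log P₂⌋₊ ⌊V * Real.log Q₂⌋₊, 1 ≤ ⌊2 * Y * Real.exp (-(v / V))⌋₊ := by
    intro v hv
    rw [Nat.one_le_floor_iff]
    have h1 : Y / Q₂ ≤ Y * Real.exp (-(v / V)) :=
      div_le_mul_exp_neg hY0.le hV0 hQ₂1 (Finset.mem_Icc.mp hv).2
    have h2 : 2 ≤ Y / Q₂ := by rw [le_div_iff₀ hQ₂0]; linarith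
    linarith
  have hcardB : ∀ B : Finset ℕ, B ⊆ Finset.Ico ⌊T₀⌋₊ (⌊T⌋₊ + 1) →
      (∀ n ∈ B, ∃ t ∈ Set.Icc (n : ℝ) (n + 1), ∃ u ∈ Icc ⌊V * Real.log P₁⌋₊ ⌊V * Real.log Q₁⌋₊,
          Real.exp (-(1 / 6 * u / V)) < ‖blockPrimePoly (lamChi χ) P₁ Q₁ V u t‖) →
      ∀ v ∈ Icc ⌊V * Real.log P₂⌋₊ ⌊V * Real.log Q₂⌋₊,
        (#B : ℝ) * Real.sqrt ((⌊T⌋₊ : ℝ) + 1) ≤ ⌈Y * Real.exp (-(v / V))⌉₊ := by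
    intro B hBsub hbad v hv
    have h1 := cardB_bound χ hL64 hcA hA1 hc1 hHx hPQ₁ hT2X hYlo hQ₂1 hF8' hF12' B hBsub hbad
    exact h1.trans (div_le_cofactorWindow hY0.le hV0 hQ₂1 (Finset.mem_Icc.mp hv).2)
  -- the five numerical inequalities (before `key`, to keep `linarith` contexts small)
  have hsrpow : 1 / V = L ^ (-(11 * A)) := by rw [hVdef, Real.rpow_neg hL0.le, one_div]
  have hT'1 : (1 : ℝ) ≤ ((⌊T⌋₊ : ℕ) : ℝ) + 1 := by simp
  have hT'0 : (0 : ℝ) < ((⌊T⌋₊ : ℕ) : ℝ) + 1 := by linarith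
  have hT'T : ((⌊T⌋₊ : ℕ) : ℝ) + 1 ≤ T + 1 := by linarith [Nat.floor_le hT0]
  have hR0 : 0 ≤ Q₁ * T / Y := by positivity
  have hs0 : 0 < 1 / V := by positivity
  have h1 : (V * Real.log (Q₁ / P₁)) *
      (Real.exp (2 * (1 / 6 : ℝ) / V) * P₁ ^ (-(2 * (1 / 6 : ℝ))) * (1 + V / (2 * (1 / 6 : ℝ)))) ≤
      24 * (1 / V) := by
    rw [hsrpow]; exact E1_factor_numerics hL1 hA hc rfl rfl hPQ₁ hlogQ₁
  have hQT : Q₁ * (((⌊T⌋₊ : ℕ) : ℝ) + 1) / Y ≤ Q₁ * T / Y + 1 := by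
    rw [div_add_one (by linarith : Y ≠ 0), div_le_div_iff_of_pos_right hY0]
    have : Q₁ * (((⌊T⌋₊ : ℕ) : ℝ) + 1) ≤ Q₁ * (T + 1) := mul_le_mul_of_nonneg_left hT'T hQ₁0.le
    nlinarith [hQ₁Y]
  have h5 : 10 * Q₁ * (((⌊T⌋₊ : ℕ) : ℝ) + 1) / Y + 72 ≤ 82 * (Q₁ * T / Y + 1) := by
    have e : 10 * Q₁ * (((⌊T⌋₊ : ℕ) : ℝ) + 1) / Y = 10 * (Q₁ * (((⌊T⌋₊ : ℕ) : ℝ) + 1) / Y) := by ring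
    rw [e]; linarith [hQT, hR0]
  have hTY : ((((⌊T⌋₊ : ℕ) : ℝ) + 1) + Y) / Y ≤ Q₁ * T / Y + 2 := by
    rw [div_le_iff₀ hY0]
    have h1' : T ≤ Q₁ * T / Y * Y := by
      rw [div_mul_cancel₀ _ (by linarith : Y ≠ 0)]
      exact le_mul_of_one_le_left hT0 hQ₁1
    have h2' : (1 : ℝ) ≤ Y := hY1
    nlinarith [h1', h2', hT'T]
  have hVP₁ : V ≤ P₁ := Real.rpow_le_rpow_of_exponent_le hL1 (by nlinarith)
  have h2 : ((((⌊T⌋₊ : ℕ) : ℝ) + 1) + Y) / Y * (1 / V + 1 / P₁) ≤ 4 * (Q₁ * T / Y + 1) * (1 / V) :=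
    err_numerics hV0 hVP₁ hR0 hY0 hT'0.le hTY
  have h4 : ((((⌊T⌋₊ : ℕ) : ℝ) + 1) + Y) / Y * (1 / V + 1 / P₂) ≤ 4 * (Q₁ * T / Y + 1) * (1 / V) :=
    err_numerics hV0 hVP₂ hR0 hY0 hT'0.le hTY
  have hlog2T' : Real.log (2 * (((⌊T⌋₊ : ℕ) : ℝ) + 1)) ≤ 2 * L := by
    have h1' : 2 * (((⌊T⌋₊ : ℕ) : ℝ) + 1) ≤ (X : ℝ) ^ 2 := by nlinarith
    calc Real.log (2 * (((⌊T⌋₊ : ℕ) : ℝ) + 1)) ≤ Real.log ((X : ℝ) ^ 2) :=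
          Real.log_le_log (by linarith) h1'
      _ = 2 * L := by rw [Real.log_pow]; push_cast; ring
  have h3 : (V * Real.log (Q₂ / P₂)) * (#(Icc ⌊V * Real.log P₂⌋₊ ⌊V * Real.log Q₂⌋₊) *
      (10 * max C₉ 0 * (3 * D * L ^ (1 - 22 * A)) ^ 2 * Real.log (2 * (((⌊T⌋₊ : ℕ) : ℝ) + 1)))) ≤
      720 * max C₉ 0 * D ^ 2 * (1 / V) := by
    rw [hsrpow]
    exact E2_factor_numerics hL1 hA hδ (le_max_right C₉ 0) rfl rfl rfl hPQ₂ hT'1 hlog2T'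
  have hK0 : 0 ≤ 10 * Q₁ * (((⌊T⌋₊ : ℕ) : ℝ) + 1) / Y + 72 := by positivity
  have hfin := final_numerics (le_max_right C₁₂ 0) (le_max_right C₉ 0) hs0.le hR0 hK0 h1 h5 h2 h3 h4
  have hRHS : max C₁₂ 0 * (2000 + 720 * max C₉ 0 * D ^ 2) * (Q₁ * T / Y + 1) * (1 / V) =
      Cf * (Q₁ * T / Y + 1) / L ^ (11 * A) := by
    rw [hCf, hVdef]; ring
  -- the main inequality at fixed `X`
  have key := prop51_fixed h12' h9' χ hY1 hT₀0 hTge hP₁1 hPQ₁ hP₂1 hPQ₂ hQP hV2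
    (by norm_num : (0 : ℝ) < 1 / 6) hUQ hN1 hcardB
  rw [filter_lichtmanTypicalWith]
  rw [← hRHS]
  exact key.trans hfin

end Literature.NumberTheory.Sieve.Lichtman2020

namespace Literature.NumberTheory.Sieve

open Lichtman2020 in
/-- **Lichtman 2020, Proposition 5.1 along `S_c` (`c ≥ 100`)** — the named fact
`Lichtman2020_dirichletMeanValueWith` of `MoebiusShiftedPrimesTypical.lean`, PROVED from the named fact
Lemma 4.5 (`Lichtman2020_primeCharacterSum`) alone (Lemmas 4.7 = MR Lemma 12 and 4.3 = MR Lemma 9 being the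
tree's proved `MatomakiRadziwill2016_lemma12_decomp_holds`, `MatomakiRadziwill2016_lemma9_holds`); the case
`Y ≤ X ≤ 2X` of `dirichletMeanValue_strong`. [cite: Lichtman2020, Proposition 5.1] -/
theorem Lichtman2020_dirichletMeanValueWith_of_primeCharacterSum
    (h45 : Lichtman2020_primeCharacterSum) : Lichtman2020_dirichletMeanValueWith := by
  intro c hc A hA δ hδ H hH hHcap
  obtain ⟨C, hC⟩ := dirichletMeanValue_strong h45 c hc A hA δ hδ H hH hHcap
  refine ⟨C, ?_⟩
  filter_upwards [hC] with X hX q hq hqA χ Y hYlo hYhi T hT0 hT2X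
  exact hX q hq hqA χ Y hYlo (hYhi.trans (by linarith [Nat.cast_nonneg (α := ℝ) X])) T hT0 hT2X

end Literature.NumberTheory.Sieve

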